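import Literature.MathematicalPhysics.QuantumFieldTheory.Balaban1983to89.B9Eq3105FamThreeLocDiffGAssembly
import Literature.MathematicalPhysics.QuantumFieldTheory.Balaban1983to89.B9ThmDCommutatorStep

/-!
# `Balaban1983to89.B9Eq3105FamThreeLocDiffGRight` — FAMILY 3 OF (3.105): THE RIGHT-LOCATED `G′`-DIFFERENCE ENTRY `hDR` SUPPLIED (FILE F3-E3) — the displayed
# input `hDR □ ν : conj b((η²·(G′(U₁) − G′_□(V′))·M_χ)^ℝ)·conj b(−η⁻¹∇*_ν) ≺ ε_D·ℓ(a)·e^{−δ_D d}` of F3-B ∕ F3-P (memo D1, GAPS G-B9-05 ∕ G-B9-p33-01) is PROVED at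
# the located cut-off `χ := χ_l = bumpY i (ctrR i □) (3S_j)` by the tree's Theorem-D road, MIRRORED: F3-E1's right identity `(G′ − G′_□)M_χl = (1 − M_{χ_□})·G′·M_χl +
# G′_□·(Δ′_□M_{χ_□} − M_{χ_□}Δ′_□)·G′·M_χl`, (3.100) for the adjoint derivative behind the cut-off, entries 2 and 0 of (3.42) for `G′(U₁)`, F3-E2a's collar
# separation, [4] (2.83)–(2.85) with one length transferred by (2.60) — modulo the member-carrier kernel `hGK` of the ADJOINT-ORDERED cube letter
# `T_χ = G′_□(V′)·(Δ′_□M_{χ_□} − M_{χ_□}Δ′_□)` (sub-row G-B9-LETTERS, GAPS G-B9-05∕family 3, programme FAMTHREE FILE F3-E3; lead g35 RULING FAMTHREE-3b (2)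
# «p38 g47 = F3-E3 = the RIGHT entry hDR»; the LEFT entry is p33 g103's `B9Eq3105FamThreeLocDiffGAssembly.hasMajorant_hDL_chiL`; division p38 g47 ∕ p33 g103 2026-08-29)

statement-level skeleton of published theorems with citation tags; proofs where landed; nothing here is a claim about the Yang–Mills mass gap

THE PRINTED LOCUS (verbatim, held `paper:balaban1985-cmp99-background-propagators`, journal page = PDF page + 388).  p. 415 l. 29–31: «Next we replace the
operators G′_{□₀} and C_{□₀} by G′_□, C_□, terms with the differences G′_{□₀} − G′_□ and C_{□₀} − C_□ are small by the same reason as before.»; p. 412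
l. 22–36: «We have proved in [2] that if we have a difference of propagators defined on two domains, then in an estimate of this difference we have, besides
the usual factors …, an exponential factor with a distance between localizations and a closest point where a change was made», «the operators may differ
outside □̃₀, and the distance from □ to □̃₀ᶜ is at least M (on L^{−j}-scale). This exponential can be estimated by (2δ₀M)⁻¹»; (3.100) p. 413 «(D_μ hA_ν)(x) =
h(x)(D_μA_ν)(x) + (∂_μh)(x)R(U(x, x+ηe_μ))A_ν(x+ηe_μ), similarly for adjoint derivatives»; (3.88)–(3.89) p. 409 (the commutator, «O(M⁻¹)»); p. 412 l. 1–9;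
(3.97) p. 412; Thm 3.1 (3.42) p. 397 (first and third members); p. 399 l. 19–24; p. 408 («We take Ω_j(□) = □̃⁴», hence □̃³ ⊂ Ω_j(□) — our gloss).  [2] = `Balaban1983RegularityDecay` (1.11)–(1.12) —
STATEMENT TYPE ONLY (print's domain-difference argument is not transcribed; the derivation below is OURS, the tree's Theorem-D road).  [4] =
`Balaban1984PropagatorsII`: (2.83)–(2.85) pp. 237–238, (2.51)–(2.52) p. 232, (2.54) p. 233, Lemma 2.1 (2.60)–(2.61) p. 234, (2.46) p. 231, (2.1)–(2.2) p. 224,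
p. 247 («|∂h_□| ≤ O(1)(MLʲη)⁻¹»); [B4-I] (1.118) p. 36.

WHY THIS FILE.  F3-B Member §4 ∕ F3-P §3 (v2) display, per cube and direction, the PAIR `hDL □ μ`, `hDR □ ν` (suppliers NONE).  p33 g103 landed the LEFT
entry (`…LocDiffGEngine` p690135, `…CommStepMember` p690353, `…LocDiffGAssembly.hasMajorant_hDL_chiL` p690816).  THIS FILE is the RIGHT entry, which is
NOT a relabelling of the left one (p33 02:52:09Z (b), two genuinely right-handed points): (i) behind `M_χl` the adjoint derivative produces, by (3.100),
COLUMN multipliers — `η²G′·M_χl·(−∇*_ν) = (η²G′·(−∇*_ν))·M_{χl(·+e_ν)} + η²G′·M_{η⁻¹(χl − χl(·+e_ν))}` — so the cut-off gradient `η⁻¹D₁θ/(3S_j)` sits on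
the located COLUMN `b′` while entry 0's profile `ℓ(a)²` sits on the global ROW `a`: one length is moved to the column by the transfer `e^{−αδ₀d(a,b′)}ℓ(a) ≤
Λℓ(b′)` ([4] (2.60), hypothesis `hT1`), where `η⁻¹ℓ(b′)/S_j ≤ 1` (§2); (ii) in the commutator piece the cube letter `T_χ = G′_□(V′)·(Δ′_□M_{χ_□} − M_{χ_□}Δ′_□)`
stands on the LEFT with global rows, the member word on the right with located columns, and the middle variable must be cut to the annulus: §3 proves the
COLUMN version of p21 D3's plateau lemma — the columns of `[M_{χ_□}, Δ′_□]` inside `NearC(3S_j − 2L^{j+1})` vanish — so `T_χ` carries its column cut-off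
for free and `hGK` is displayed as a plain kernel `θ_K·e^{−b_Kδ₀d}`; §1 `sepLeftCol_majorant_blk` is [4] (2.83) in this orientation (middle cut, located
columns, one `ℓ(y″)` transferred to the row by `hTst`, the member (2.61)).  The gap piece `(1 − M_{χ_□})·G′·M_χl·(−∇*)` has FAR ROWS and located columns:
`colSep_majorant_blk` (mirror of p38 F3-D1 `rowSep_majorant_blk`) with F3-E2a's collar separation flipped.

WHAT THIS FILE CERTIFIES (kernel-checked; 0 `def`, 0 `def … : Prop`, 0 sorry; standard axioms only)

* §1 (generic geometry `g`) `hasMajorant_mul_mulOp_right_weight` (a COLUMN-weighted multiplier: `T·M_f ≺ K(a,b′)·w(b′)`), ★ `colSep_majorant_blk`,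
  ★★ `sepLeftCol_majorant_blk` (`T_L ≺ θe^{−b_Lδ₀d}`, `T_R ≺ 𝟙[y″ ∈ Z]𝟙[b′ ∈ S]κw(y″)e^{−a_Rδ₀d}`, `sep(Z,S) ≥ D` ⟹ `T_LT_R ≺ 𝟙[b′ ∈ S]·θκC·c₁(δ₀, a_R − a_sep − ρ)·
  e^{−a_sepδ₀D}·w_A(a)·e^{−ρδ₀d}`, `α_st + ρ ≤ b_L`).
* §2 `conj_smul_cutMulY` (p33's engine `smul_cutMulY_ofReal` under `conj b`), `conj_one_sub_cutMulY_site`, ★ `conj_cut_gradB_split` ((3.100) for `−∇*_ν` behind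
  `M_χl`, any left factors `Y, O`; F3-E1 `cutMulY_mul_diffLetter_inr` BY NAME), ★ `hasMajorant_colL_G_gradB` (entry 2: `≺ 𝟙[b′ ∈ S_l]·M₂Σ‖b_j‖B_G·ℓ(a)·e^{−δ_Gd}`),
  ★ `hasMajorant_colL_G_dchi` (entry 0 + transfer: `≺ 𝟙[b′ ∈ S_l]·M₂Σ‖b_j‖B_GΛ(D₁θ/3)·ℓ(a)·e^{−(a_G − α)δ₀d}`).
* §3 ★ `comm_cutMulY_chiY_apply_colCut` (p21 `B9ThmDCubePlateau.nearC_of_mem_stencilY_rev'` BY NAME), ★ `conj_GK_eq_mul_mulOp_colCut` (`conj b(T_χ^ℝ) = conj b(T_χ^ℝ)·M_{𝟙[¬NearC(3S_j − 2L^{j+1})]}♯`),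
  `collar_le_dist_chiL_annulus2` (`3M_h/8 − 3 ≤ d`).
* §4 ★★ `hasMajorant_gapPieceR`: `conj b((η²(1 − M_{χ_□})G′(U₁)M_χl)^ℝ)·conj b(−η⁻¹∇*_ν) ≺ 𝟙[b′ ∈ S_l]·(M₂Σ‖b_j‖B_G(1 + ΛD₁θ/3)e^{−a_sepδ₀(3M_h/8 − 1)})·ℓ(a)·e^{−ρδ₀d}`.
* §5 ★★ `hasMajorant_commPieceR`: `conj b((η²T_χG′(U₁)M_χl)^ℝ)·conj b(−η⁻¹∇*_ν) ≺ 𝟙[b′ ∈ S_l]·(M₂Σ‖b_j‖B_G(1 + ΛD₁θ/3)θ_KΛ_st·c₁·e^{−a_sepδ₀(3M_h/8 − 3)})·ℓ(a)·e^{−ρδ₀d}`,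
  modulo `hGK`.
* §6 ★★★ `hasMajorant_hDR_of_identity` (any gauge-law-free letters `O, parS, V′`, modulo F3-E1's right identity `hId` and `hGK`):
  `conj b((η²·(O(U₁) − G′_□(V′))·M_χl)^ℝ)·conj b(−η⁻¹∇*_ν(U₁)) ≺ ε_D^R·ℓ(a)·e^{−ρδ₀d}`,
  `ε_D^R = M₂Σ‖b_j‖B_G(1 + ΛD₁θ/3)·(e^{−a_sepδ₀(3M_h/8 − 1)} + θ_KΛ_st·c₁(δ₀, a_G − α − a_sep − ρ)·e^{−a_sepδ₀(3M_h/8 − 3)})` — F3-P v2's `hDR □ ν` shape at `χ □ := χ_l`,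
  `δD = ρδ₀`; ★★★ `hasMajorant_hDR_at` — the same AT THE (3.35) DATUM (`parS := parSymY i`, `O := GpY i parSymY`, `V′ := gaugeY i g⁻¹ (locCfgY i □ η A)`), `hId`
  DISCHARGED by F3-E1 §4 `GpY_sub_GpCubeY_cutMulY_eq_at` (+ p21 `comm_cutMulY_chiY_deltaPrimeACubeY`, F3-E2a `chiL_mul_chiY`).

HONEST SCOPE ∕ NOT CLAIMED.  (i) The RIGHT entry only; the left entry is p33's (landed).  (ii) DISPLAYED, with named suppliers not invoked here: `hGK` — the
member-carrier kernel `θ_K·e^{−b_Kδ₀d}` of `conj b(T_χ^ℝ)` for the ADJOINT-ORDERED letter `T_χ = G′_□(V′)·(Δ′_□M_{χ_□} − M_{χ_□}Δ′_□)` (p21 D3 bounds the other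
order `[M_χ, Δ′_□]·G′_□`; a supplier needs D3's mirror on the cube carrier + p38 `B9Cor36SiteSandwichTransfer` ∕ g58 — NOT in the tree as of this file); `hE`
((3.42) for `G′(U₁)`); the unit hypotheses; `η = |c_f|⁻¹`; the two length transfers `hT1`, `hTst` ([4] (2.60) for `w = ℓ`, supplied in the tree per weight by
`B9Ineq347`-type lemmas at admissible `(α, Λ)` — not instantiated here); the member (2.61) at `(δ₀, a_G − α − a_sep − ρ)`; the budgets `α + a_sep + ρ ≤ a_G`,
`a_Gδ₀ ≤ δ_G`, `α_st + ρ ≤ b_K`.  (iii) Constants are the tree's (`3/8`, `21/8`, `D₁θ/3`, `3M_h/8 − 3 ≥ 0` as `M_h ≥ 8`); print's `O(e^{−2δ₀M})` quality is not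
claimed.  (iv) [2] (1.11)–(1.12) is cited for the statement type only.  Count-neutral; NOT a node discharge; no summit ∕ sub-problem statement is proved;
nothing continuum ∕ OS ∕ mass-gap ∕ Clay; YM mass gap NOT proved (Track A conditional rung).  No `sorry`, no `axiom`, no `… : Prop` fact, no `instance`, no
`notation`, no `def`.  NEW file; nothing landed is modified.  Cell `lit-balaban`, seat `lit-balaban-p38` gen 47, 2026-08-29; `--supports stmt-QuantumFields-19200`
as helper.  Net new unproved facts: 0.

RELATED IN THE TREE, NOT DUPLICATED (searched 2026-08-29: `rg 'LocDiffGRight|gapPieceR|commPieceR|sepLeftCol|colSep_majorant' Literature/` = ∅): p33 F3-E1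
`B9Eq3105FamThreeLocDiffG` (the right identity + (3.100) behind a cut-off — USED BY NAME), p33 engine `B9Eq3105FamThreeLocDiffGEngine` (`smul_cutMulY_ofReal` BY
NAME; its `hasMajorant_mulOp_left_wt`∕`leftFactor`∕`gapPiece`∕`commPiece` are LEFT-worded — rows located — and not reusable verbatim here, p33 02:52:09Z (b)),
p33 `B9Eq3105FamThreeLocDiffGAssembly` (`abs_chiL_le_one`, `nearC_of_chiL_shiftY_ne_zero`, `abs_chiL_shiftY_sub_le`, `abs_one_sub_chiY_le_one` BY NAME; its
`hasMajorant_hDL_chiL` is the LEFT twin), p38 F3-E2a `B9Cor36CollarSeparation` (BY NAME), p38 F3-D1 `B9Eq3105FamThreeTFar.exp_sep_split`, r05∕p21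
`B9Thm39CinvSepMiddle.hasMajorant_mulOp_rows`, p21 `B9Eq395Small.hasMajorant_mul_mulOp_right`, `B9CubeLettersInvReadDict` (entries 0∕2), p21
`B9ThmDCommutatorStep.comm_cutMulY_chiY_apply_eq_zero_of_nearC` ∕ `B9ThmDCubePlateau`, `B9Cor36GpCubeLocLetter.deltaPrimeACubeY_apply_congr_stencil`,
`B9Ineq347.ScaleTransfer`, `B9Cor36SiteSandwichTransfer.geo9K_len_site`, Z2-core `B9Eq3105FamTwoCore` — all USED BY NAME.
-/

noncomputable section

namespace Literature.MathematicalPhysics.QuantumFieldTheory.Balaban1983to89.B9Eq3105FamThreeLocDiffGRight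

open NormedSpace Complex
open B6RandomWalk (HasMajorant BlockSupp hasMajorant_mono hasMajorant_add hasMajorant_mul Ineq261 c1_nonneg Triangle254)
open B9FromB6 (EBlock)
open B9Thm34Ext (toB6)
open B9Thm37Sum (mulOp mulOp_apply)
open B9Eq352DivFormLetters (conj)
open B9Eq352GradLetters (diffLetter)
open B4PartitionUnity22 (thetaProf D1 D1_nonneg contDiff_thetaProf hasCompactSupport_thetaProf)
open B6KLevelCensusIndexV1 (KIdx kGeo)
open B6Cover236MultiLevelBlocks (cubes)
open B6GlobalChartV1 (PV boxEquiv)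
open B6Geom246MultiLevelBox (blkOf)
open B6Ineq2142KLevelV1 (β)
open B9GeoNormsKLevelV1 (geo9K)
open B9GeoLemma21KLevelV1 (one_le_Mh geo9K_dist_nonneg' geo9K_dist_comm)
open B9Ineq347 (ScaleTransfer)
open B9Eq39Adjoint (fluct)
open B9Eq360DeltaPrimeAY (AfldY)
open B9Thm37CubeCoverCommutators (cutMulY cutMulY_apply KhY stencilY)
open B9Thm39CinvTorusRegular (conj_cutMulY)
open B9Thm39CinvSepMiddle (hasMajorant_mulOp_rows)
open B9Eq395Small (hasMajorant_mulOp_left hasMajorant_mul_mulOp_right)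
open B9Cor36CutoffField337 (bumpY)
open B9Cor36CubeCutoffs (SC NearC ctrR chiY locCfgY one_le_SC nearC_shiftY nearC_shiftY_symm pow_levY_le_SC chiY_eq_one_of_nearC nearC_of_blkOf_eq levY_eq_of_blkOf_eq)
open B9Cor36CubeTwinsGeometry (bS one_le_bS eight_mul_bS_le_SC)
open B9Cor36SiteSandwichTransfer (geo9K_len_site)
open B9Cor36CollarSeparation (nearC_of_chiL_ne_zero not_nearC_of_chiY_ne_one collar_le_dist_chiL_chiY collar_le_dist_of_nearC_of_not_nearC chiL_mul_chiY)
open B9CubeLettersOpsL0 (GpCubeY deltaPrimeACubeY)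
open B9CubeLettersInvReadings (kernelFamilySInv)
open B9CubeLettersInvReadDict (hasMajorant_conj_G_of_eBlockInv hasMajorant_G_mul_gradB_of_eBlockInv)
open B9ThmDCubePlateau (comm_cutMulY_chiY_deltaPrimeACubeY nearC_of_mem_stencilY_rev')
open B9ThmDCommutatorStep (comm_cutMulY_chiY_apply_eq_zero_of_nearC)
open B9Cor36GpCubeLocLetter (deltaPrimeACubeY_apply_congr_stencil)
open B9Ineq349SiteComposite (etaS_pos)
open B9Eq3105FamTwoCore (geo9K_axioms)
open B9Eq3105FamThreeLocDiffG (cutMulY_mul_diffLetter_inr GpY_sub_GpCubeY_cutMulY_eq_at)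
open B9Eq3105FamThreeLocDiffGEngine (smul_cutMulY_ofReal)
open B9Eq3105FamThreeLocDiffGAssembly (three_SC_pos abs_chiL_le_one nearC_of_chiL_shiftY_ne_zero abs_chiL_shiftY_sub_le abs_one_sub_chiY_le_one)
open Node00 (SiteY BlkY IBondY CfgY GaugeY SiteOpY SiteParY toKT etaS shiftY UboxY levY gaugeY parSymY GpY deltaPrimeAY)

variable {d ℓ : ℕ} {hd : 1 ≤ d + 1} {hL : Odd (ℓ + 1) ∧ 1 < ℓ + 1} {b₀ b₁ : ℝ}
variable {𝔸 : Type} [NormedRing 𝔸] [NormedAlgebra ℂ 𝔸] [CompleteSpace 𝔸]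
variable {ι : Type} [Fintype ι]
variable (i : KIdx d ℓ hd hL b₀ b₁) (c : ↥(cubes (toKT i).D.toDomains)) (b : Module.Basis ι ℝ 𝔸)

/-! ## §1  Kernel bookkeeping: a column-weighted multiplier; two column separations; the mirrored (3.100) split -/

section Kernel

variable {X : Type} {g : B9.Geometry} [Fintype g.Site] [DecidableEq g.Site] {R : ℝ} {H : Prop}

omit [DecidableEq g.Site] in
/-- a multiplier on the RIGHT bounded by a COLUMN WEIGHT: `|f(x)| ≤ w(y(x))`, `w ≥ 0`, `T ≺ K` ⟹ `T·M_f ≺ K(a, b′)·w(b′)` (the test function `f·λ` on the block `b′` is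
bounded by `w(b′)·|λ|`). [cite: Balaban1984PropagatorsII, (2.51) p.232, bookkeeping] -/
theorem hasMajorant_mul_mulOp_right_weight (blk : X → g.Site) {T : Module.End ℝ (X → ℝ)} {K : g.Site → g.Site → ℝ}
    (hT : HasMajorant (g := toB6 g R H) blk T K) (f : X → ℝ) (w : g.Site → ℝ) (hw : ∀ y, 0 ≤ w y) (hf : ∀ x, |f x| ≤ w (blk x)) :
    HasMajorant (g := toB6 g R H) blk (T * mulOp f) (fun (a b' : g.Site) => K a b' * w b') := by
  intro (y' : g.Site) μ B hμ x
  have hμ' : BlockSupp (g := toB6 g R H) blk (mulOp f μ) y' (w y' * B) := by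
    refine ⟨mul_nonneg (hw y') hμ.nonneg, fun x' hx' => ?_, fun x' hx' => ?_⟩
    · rw [mulOp_apply, abs_mul]
      have h1 : |f x'| ≤ w y' := by rw [← hx']; exact hf x'
      exact mul_le_mul h1 (hμ.bound x' hx') (abs_nonneg _) (hw y')
    · rw [mulOp_apply, hμ.off x' hx', mul_zero]
  have hb := hT y' _ _ hμ' x
  rw [Module.End.mul_apply]
  calc |T (mulOp f μ) x| ≤ K (blk x) y' * (w y' * B) := hb
    _ = K (blk x) y' * w y' * B := by ring

/-- **ROWS CUT FAR, COLUMNS LOCATED NEAR — the separation as a small factor** (mirror of p38 F3-D1 `rowSep_majorant_blk`): `T ≺ 𝟙[b′ ∈ S]·κ·w(a)·e^{−r_T d}`, a row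
cut-off `m` supported over blocks `Z`, `D_sep ≤ d(y, b′)` for `y ∈ Z`, `b′ ∈ S`, `r_sep + r_ρ ≤ r_T` ⟹ `M_m·T ≺ 𝟙[b′ ∈ S]·(κe^{−r_sepD_sep})·w(a)·e^{−r_ρd}`.
[cite: Balaban1985BackgroundPropagators, p.412 l.31–36, p.415 l.21–24; Balaban1984PropagatorsII, (2.83)–(2.85) pp.237–238] -/
theorem colSep_majorant_blk (blk : X → g.Site) {rT rsep rρ κ Dsep : ℝ} (w : g.Site → ℝ) (S Z : Finset g.Site) (m : X → ℝ)
    (hκ : 0 ≤ κ) (hw : ∀ y, 0 ≤ w y) (hrsep : 0 ≤ rsep) (hsplit : rsep + rρ ≤ rT)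
    (hdnn : ∀ a y : g.Site, 0 ≤ g.dist a y)
    (hm1 : ∀ x, |m x| ≤ 1) (hm0 : ∀ x, blk x ∉ Z → m x = 0) (hsep : ∀ y ∈ Z, ∀ b' ∈ S, Dsep ≤ g.dist y b')
    {T : Module.End ℝ (X → ℝ)}
    (hT : HasMajorant (g := toB6 g R H) blk T
      (fun (a b' : g.Site) => (if b' ∈ S then (1 : ℝ) else 0) * (κ * w a * Real.exp (-(rT * g.dist a b'))))) :
    HasMajorant (g := toB6 g R H) blk (mulOp m * T)
      (fun (a b' : g.Site) => (if b' ∈ S then (1 : ℝ) else 0) * ((κ * Real.exp (-(rsep * Dsep))) * w a * Real.exp (-(rρ * g.dist a b')))) := by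
  have hZ := hasMajorant_mulOp_rows (R := R) (H := H) blk hT m hm1 Z hm0
  refine hasMajorant_mono (g := toB6 g R H) _ hZ fun (a b' : g.Site) => ?_
  have hrhs : 0 ≤ (if b' ∈ S then (1 : ℝ) else 0) * ((κ * Real.exp (-(rsep * Dsep))) * w a * Real.exp (-(rρ * g.dist a b'))) :=
    mul_nonneg (by split_ifs <;> norm_num) (mul_nonneg (mul_nonneg (mul_nonneg hκ (Real.exp_nonneg _)) (hw a)) (Real.exp_nonneg _))
  by_cases ha : a ∈ Z
  · by_cases hb' : b' ∈ S
    · show (if a ∈ Z then (1 : ℝ) else 0) * ((if b' ∈ S then (1 : ℝ) else 0) * (κ * w a * Real.exp (-(rT * g.dist a b')))) ≤ _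
      rw [if_pos ha, if_pos hb', one_mul, one_mul, one_mul]
      have hE := B9Eq3105FamThreeTFar.exp_sep_split hrsep hsplit (hdnn a b') (hsep a ha b' hb')
      calc κ * w a * Real.exp (-(rT * g.dist a b')) = κ * w a * Real.exp (-(rT * g.dist a b')) := rfl
        _ ≤ κ * w a * (Real.exp (-(rsep * Dsep)) * Real.exp (-(rρ * g.dist a b'))) :=
            mul_le_mul_of_nonneg_left hE (mul_nonneg hκ (hw a))
        _ = _ := by ring
    · show (if a ∈ Z then (1 : ℝ) else 0) * ((if b' ∈ S then (1 : ℝ) else 0) * (κ * w a * Real.exp (-(rT * g.dist a b')))) ≤ _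
      rw [if_neg hb', zero_mul, mul_zero, zero_mul]
  · show (if a ∈ Z then (1 : ℝ) else 0) * ((if b' ∈ S then (1 : ℝ) else 0) * (κ * w a * Real.exp (-(rT * g.dist a b')))) ≤ _
    rw [if_neg ha, zero_mul]
    exact hrhs

/-- ★ **[4] (2.83) WITH THE SEPARATION BETWEEN THE MIDDLE VARIABLE AND LOCATED COLUMNS** (the `hDR` orientation: cube letter on the LEFT with global rows and
columns global, member letter on the right with ROWS cut to `Z` and columns located in `S`): `T_L ≺ θ·e^{−bδ₀d(a,y″)}`, `T_R ≺ 𝟙[y″ ∈ Z]·𝟙[b′ ∈ S]·κ·w(y″)·e^{−a_Rδ₀d(y″,b′)}`,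
`D_sep ≤ d(y″, b′)` on `Z × S`, the transfer `e^{−α_stδ₀d(a,y″)}w(y″) ≤ C·w_A(a)`, (2.61) at `(δ₀, a_R − a_sep − ρ)`, `α_st + ρ ≤ b`:
`T_L·T_R ≺ 𝟙[b′ ∈ S]·(θκC·c₁·e^{−a_sepδ₀D_sep})·w_A(a)·e^{−ρδ₀d(a,b′)}`.
[cite: Balaban1984PropagatorsII, (2.83)–(2.85) pp.237–238, (2.52) p.232, (2.54) p.233, Lemma 2.1 (2.60)–(2.61) p.234; Balaban1985BackgroundPropagators, p.412 l.1–9 + l.22–36] -/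
theorem sepLeftCol_majorant_blk (blk : X → g.Site) (dB : ℕ) (δ₀ aR αst asep ρ bL θ κ C Dsep : ℝ) (w wA : g.Site → ℝ) (S Z : Finset g.Site)
    (hθ : 0 ≤ θ) (hκ : 0 ≤ κ) (hC : 0 ≤ C) (hw : ∀ y, 0 ≤ w y) (hwA : ∀ y, 0 ≤ wA y) (hδ₀ : 0 ≤ δ₀) (hasep : 0 ≤ asep) (hρ : 0 ≤ ρ)
    (hsplitL : αst + ρ ≤ bL)
    (htri : Triangle254 (toB6 g R H)) (hsymm : ∀ a b : g.Site, g.dist a b = g.dist b a) (hdnn : ∀ a b : g.Site, 0 ≤ g.dist a b)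
    (hST : ∀ a y'' : g.Site, Real.exp (-(αst * δ₀ * g.dist a y'')) * w y'' ≤ C * wA a)
    (h261 : Ineq261 dB (toB6 g R H) δ₀ (aR - asep - ρ))
    (hsep : ∀ y'' ∈ Z, ∀ b' ∈ S, Dsep ≤ g.dist y'' b')
    {TL TR : Module.End ℝ (X → ℝ)}
    (hL : HasMajorant (g := toB6 g R H) blk TL (fun (a y'' : g.Site) => θ * Real.exp (-(bL * δ₀ * g.dist a y''))))
    (hR : HasMajorant (g := toB6 g R H) blk TR
      (fun (y'' b' : g.Site) => (if y'' ∈ Z then (1 : ℝ) else 0) *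
        ((if b' ∈ S then (1 : ℝ) else 0) * (κ * w y'' * Real.exp (-(aR * δ₀ * g.dist y'' b')))))) :
    HasMajorant (g := toB6 g R H) blk (TL * TR)
      (fun (a b' : g.Site) => (if b' ∈ S then (1 : ℝ) else 0) *
        ((θ * κ * C * B6.c1 dB δ₀ (aR - asep - ρ) * Real.exp (-(asep * δ₀ * Dsep))) * wA a * Real.exp (-(ρ * δ₀ * g.dist a b')))) := by
  have hK₂ : ∀ y'' b' : g.Site, 0 ≤ (if y'' ∈ Z then (1 : ℝ) else 0) *
      ((if b' ∈ S then (1 : ℝ) else 0) * (κ * w y'' * Real.exp (-(aR * δ₀ * g.dist y'' b')))) := fun y'' b' =>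
    mul_nonneg (by split_ifs <;> norm_num) (mul_nonneg (by split_ifs <;> norm_num) (mul_nonneg (mul_nonneg hκ (hw y'')) (Real.exp_nonneg _)))
  have hLR := hasMajorant_mul (g := toB6 g R H) blk hL hR hK₂
  refine hasMajorant_mono (g := toB6 g R H) _ hLR fun (a b' : g.Site) => ?_
  have hc1 : 0 ≤ B6.c1 dB δ₀ (aR - asep - ρ) := c1_nonneg dB δ₀ _
  by_cases hb' : b' ∈ S
  swap
  · show ∑ y'' : g.Site, θ * Real.exp (-(bL * δ₀ * g.dist a y'')) *
        ((if y'' ∈ Z then (1 : ℝ) else 0) * ((if b' ∈ S then (1 : ℝ) else 0) * (κ * w y'' * Real.exp (-(aR * δ₀ * g.dist y'' b'))))) ≤ _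
    simp only [hb', if_false, zero_mul, mul_zero, Finset.sum_const_zero]
    exact le_refl _
  show ∑ y'' : g.Site, θ * Real.exp (-(bL * δ₀ * g.dist a y'')) *
      ((if y'' ∈ Z then (1 : ℝ) else 0) * ((if b' ∈ S then (1 : ℝ) else 0) * (κ * w y'' * Real.exp (-(aR * δ₀ * g.dist y'' b'))))) ≤
    (if b' ∈ S then (1 : ℝ) else 0) *
      ((θ * κ * C * B6.c1 dB δ₀ (aR - asep - ρ) * Real.exp (-(asep * δ₀ * Dsep))) * wA a * Real.exp (-(ρ * δ₀ * g.dist a b')))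
  simp only [hb', if_true, one_mul]
  have hΘ0 : 0 ≤ θ * κ * C * Real.exp (-(asep * δ₀ * Dsep)) * wA a :=
    mul_nonneg (mul_nonneg (mul_nonneg (mul_nonneg hθ hκ) hC) (Real.exp_nonneg _)) (hwA a)
  have hcoefρ : 0 ≤ ρ * δ₀ := mul_nonneg hρ hδ₀
  -- termwise: split the right factor's rate `a_R = α'… ` no: split the LEFT rate `b_L ≥ α_st + ρ` for the transfer and the triangle, the RIGHT rate
  -- `a_R ≥ a_sep + ρ'`… we use: e^{-b_L d(a,y″)} ≤ e^{-α_st d(a,y″)}·e^{-ρ d(a,y″)}, e^{-a_R d(y″,b′)} ≤ e^{-a_sep D}·e^{-ρ d(y″,b′)}… wait we need (2.61) in y″: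
  -- keep e^{-(a_R − a_sep − ρ) d(y″,b′)} for the sum, use e^{-ρ d(a,y″)}·e^{-ρ d(y″,b′)} ≤ e^{-ρ d(a,b′)} (triangle).
  have hterm : ∀ y'' : g.Site,
      θ * Real.exp (-(bL * δ₀ * g.dist a y'')) * ((if y'' ∈ Z then (1 : ℝ) else 0) * (κ * w y'' * Real.exp (-(aR * δ₀ * g.dist y'' b')))) ≤
        θ * κ * C * Real.exp (-(asep * δ₀ * Dsep)) * wA a * Real.exp (-(ρ * δ₀ * g.dist a b')) *
          Real.exp (-((aR - asep - ρ) * δ₀ * g.dist b' y'')) := by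
    intro y''
    by_cases hy'' : y'' ∈ Z
    · simp only [hy'', if_true, one_mul]
      have hsplitexpL : Real.exp (-(bL * δ₀ * g.dist a y'')) ≤ Real.exp (-(αst * δ₀ * g.dist a y'')) * Real.exp (-(ρ * δ₀ * g.dist a y'')) := by
        rw [← Real.exp_add]
        refine Real.exp_le_exp.mpr ?_
        have h1 := mul_le_mul_of_nonneg_right hsplitL (mul_nonneg hδ₀ (hdnn a y''))
        nlinarith [h1]
      have hsplitexpR : Real.exp (-(aR * δ₀ * g.dist y'' b')) ≤
          Real.exp (-(asep * δ₀ * g.dist y'' b')) * Real.exp (-(ρ * δ₀ * g.dist y'' b')) * Real.exp (-((aR - asep - ρ) * δ₀ * g.dist y'' b')) := by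
        rw [← Real.exp_add, ← Real.exp_add]
        exact Real.exp_le_exp.mpr (le_of_eq (by ring))
      have hst : Real.exp (-(αst * δ₀ * g.dist a y'')) * w y'' ≤ C * wA a := hST a y''
      have hsepexp : Real.exp (-(asep * δ₀ * g.dist y'' b')) ≤ Real.exp (-(asep * δ₀ * Dsep)) := by
        refine Real.exp_le_exp.mpr ?_
        have h1 := mul_le_mul_of_nonneg_left (hsep y'' hy'' b' hb') (mul_nonneg hasep hδ₀)
        linarith
      have htri' : Real.exp (-(ρ * δ₀ * g.dist a y'')) * Real.exp (-(ρ * δ₀ * g.dist y'' b')) ≤ Real.exp (-(ρ * δ₀ * g.dist a b')) := by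
        rw [← Real.exp_add]
        refine Real.exp_le_exp.mpr ?_
        have h0 : g.dist a b' ≤ g.dist a y'' + g.dist y'' b' := htri a y'' b'
        have h1 := mul_le_mul_of_nonneg_left h0 hcoefρ
        nlinarith [h1]
      have hsym : Real.exp (-((aR - asep - ρ) * δ₀ * g.dist y'' b')) = Real.exp (-((aR - asep - ρ) * δ₀ * g.dist b' y'')) := by rw [hsymm y'' b']
      have hθκ : 0 ≤ θ * κ := mul_nonneg hθ hκ
      calc θ * Real.exp (-(bL * δ₀ * g.dist a y'')) * (κ * w y'' * Real.exp (-(aR * δ₀ * g.dist y'' b')))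
          = θ * κ * (Real.exp (-(bL * δ₀ * g.dist a y'')) * w y'') * Real.exp (-(aR * δ₀ * g.dist y'' b')) := by ring
        _ ≤ θ * κ * (Real.exp (-(αst * δ₀ * g.dist a y'')) * Real.exp (-(ρ * δ₀ * g.dist a y'')) * w y'') *
              (Real.exp (-(asep * δ₀ * g.dist y'' b')) * Real.exp (-(ρ * δ₀ * g.dist y'' b')) * Real.exp (-((aR - asep - ρ) * δ₀ * g.dist y'' b'))) := by
            refine mul_le_mul (mul_le_mul_of_nonneg_left (mul_le_mul_of_nonneg_right hsplitexpL (hw y'')) hθκ) hsplitexpR (Real.exp_nonneg _) ?_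
            exact mul_nonneg hθκ (mul_nonneg (mul_nonneg (Real.exp_nonneg _) (Real.exp_nonneg _)) (hw y''))
        _ = θ * κ * (Real.exp (-(αst * δ₀ * g.dist a y'')) * w y'') * Real.exp (-(asep * δ₀ * g.dist y'' b')) *
              (Real.exp (-(ρ * δ₀ * g.dist a y'')) * Real.exp (-(ρ * δ₀ * g.dist y'' b'))) * Real.exp (-((aR - asep - ρ) * δ₀ * g.dist y'' b')) := by ring
        _ ≤ θ * κ * (C * wA a) * Real.exp (-(asep * δ₀ * Dsep)) * Real.exp (-(ρ * δ₀ * g.dist a b')) *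
              Real.exp (-((aR - asep - ρ) * δ₀ * g.dist y'' b')) := by
            refine mul_le_mul_of_nonneg_right ?_ (Real.exp_nonneg _)
            refine mul_le_mul ?_ htri' (mul_nonneg (Real.exp_nonneg _) (Real.exp_nonneg _)) ?_
            · exact mul_le_mul (mul_le_mul_of_nonneg_left hst hθκ) hsepexp (Real.exp_nonneg _) (mul_nonneg hθκ (mul_nonneg hC (hwA a)))
            · exact mul_nonneg (mul_nonneg hθκ (mul_nonneg hC (hwA a))) (Real.exp_nonneg _)
        _ = _ := by rw [hsym]; ring
    · simp only [hy'', if_false, zero_mul, mul_zero]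
      exact mul_nonneg (mul_nonneg hΘ0 (Real.exp_nonneg _)) (Real.exp_nonneg _)
  calc ∑ y'' : g.Site, θ * Real.exp (-(bL * δ₀ * g.dist a y'')) *
          ((if y'' ∈ Z then (1 : ℝ) else 0) * (κ * w y'' * Real.exp (-(aR * δ₀ * g.dist y'' b'))))
      ≤ ∑ y'' : g.Site, θ * κ * C * Real.exp (-(asep * δ₀ * Dsep)) * wA a * Real.exp (-(ρ * δ₀ * g.dist a b')) *
          Real.exp (-((aR - asep - ρ) * δ₀ * g.dist b' y'')) := Finset.sum_le_sum fun y'' _ => hterm y''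
    _ = θ * κ * C * Real.exp (-(asep * δ₀ * Dsep)) * wA a * Real.exp (-(ρ * δ₀ * g.dist a b')) *
          ∑ y'' : g.Site, Real.exp (-((aR - asep - ρ) * δ₀ * g.dist b' y'')) := by rw [Finset.mul_sum]
    _ ≤ θ * κ * C * Real.exp (-(asep * δ₀ * Dsep)) * wA a * Real.exp (-(ρ * δ₀ * g.dist a b')) * B6.c1 dB δ₀ (aR - asep - ρ) :=
        mul_le_mul_of_nonneg_left (h261 b') (mul_nonneg hΘ0 (Real.exp_nonneg _))
    _ = _ := by ring

end Kernel

/-! ## §2  The mirrored (3.100) split and the two COLUMN pieces: columns within one step of `supp χ_l`, profile `ℓ(a)` -/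

section Cols

variable [Fintype (geo9K i).Site] [DecidableEq (geo9K i).Site] {Rr : ℝ} {Hp : Prop}
variable {B : B9.Backgrounds} (cfg : B.Cfg → CfgY 𝔸 i) (O : SiteOpY 𝔸 i) (parS : SiteParY 𝔸 i) {U₁ : B.Cfg}

omit [CompleteSpace 𝔸] [Fintype (geo9K i).Site] [DecidableEq (geo9K i).Site] in
/-- `(c • M_f)^ℝ` with `c = (r : ℂ)` is the real multiplier `M_{r·f}` in coordinates (p33's engine `smul_cutMulY_ofReal` under `conj b`).
[cite: Balaban1984PropagatorsII, (2.51) p.232, bookkeeping] -/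
theorem conj_smul_cutMulY (r : ℝ) (f : SiteY i → ℝ) :
    conj b ((((r : ℝ) : ℂ) • cutMulY (𝔸 := 𝔸) f).restrictScalars ℝ) = mulOp (fun p : SiteY i × ι => r * f p.1) := by
  rw [smul_cutMulY_ofReal, conj_cutMulY]

omit [CompleteSpace 𝔸] [Fintype (geo9K i).Site] [DecidableEq (geo9K i).Site] in
/-- `conj b((1 − M_χ)^ℝ) = M_{1 − χ♯}` on the real coordinates of the site carrier. [cite: Balaban1984PropagatorsII, (2.51) p.232, bookkeeping] -/
theorem conj_one_sub_cutMulY_site (χ : SiteY i → ℝ) :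
    conj b ((1 - cutMulY (𝔸 := 𝔸) χ).restrictScalars ℝ : Module.End ℝ (SiteY i → 𝔸)) = mulOp (fun p : SiteY i × ι => 1 - χ p.1) := by
  have h1 : ((1 - cutMulY (𝔸 := 𝔸) χ).restrictScalars ℝ : Module.End ℝ (SiteY i → 𝔸)) = 1 - (cutMulY (𝔸 := 𝔸) χ).restrictScalars ℝ :=
    LinearMap.ext fun _ => rfl
  rw [h1, B9Eq352DivFormLetters.conj_sub, B9Cor35GpCubeInputsAtOne.conj_one', conj_cutMulY, B9Eq3105FamTwoCore.one_sub_mulOp]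

omit [Fintype (geo9K i).Site] [DecidableEq (geo9K i).Site] in
/-- ★ **THE RIGHT-LOCATED WORD THROUGH THE ADJOINT DERIVATIVE, IN REAL COORDINATES** ((3.100) «similarly for adjoint derivatives»: `M_χl(−∇*_ν) = (−∇*_ν)M_{χl(·+e_ν)} +
η⁻¹M_{χl − χl(·+e_ν)}`): for any ℂ-linear `Y, O`,
`conj b((η²·(Y ∘ O ∘ M_χl))^ℝ)·conj b(−η⁻¹∇*_ν) = conj b(Y^ℝ)·(conj b((η²O)^ℝ)·conj b(−η⁻¹∇*_ν))·M_{χl(·+e_ν)}♯ + conj b(Y^ℝ)·conj b((η²O)^ℝ)·M_{η⁻¹(χl − χl(·+e_ν))}♯`.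
[cite: Balaban1985BackgroundPropagators, (3.100) p.413, (3.8) p.392; Balaban1984PropagatorsII, (2.52) p.232] -/
theorem conj_cut_gradB_split (U : CfgY 𝔸 i) (η : ℝ) (ν : Fin (d + 1)) (χl : SiteY i → ℝ) (Y O : (SiteY i → 𝔸) →ₗ[ℂ] (SiteY i → 𝔸)) :
    conj b (((η ^ 2) • ((Y ∘ₗ O) ∘ₗ cutMulY (𝔸 := 𝔸) χl)).restrictScalars ℝ) *
        conj b (diffLetter (shiftY i) (UboxY i U) (((η : ℝ) : ℂ))⁻¹ (Sum.inr ν)) =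
      conj b (Y.restrictScalars ℝ) *
          (conj b (((η ^ 2) • O).restrictScalars ℝ) * conj b (diffLetter (shiftY i) (UboxY i U) (((η : ℝ) : ℂ))⁻¹ (Sum.inr ν))) *
          mulOp (fun p : SiteY i × ι => χl (shiftY i ν p.1)) +
        conj b (Y.restrictScalars ℝ) * conj b (((η ^ 2) • O).restrictScalars ℝ) *
          mulOp (fun p : SiteY i × ι => η⁻¹ * (χl p.1 - χl (shiftY i ν p.1))) := by
  have e1 : (((η ^ 2) • ((Y ∘ₗ O) ∘ₗ cutMulY (𝔸 := 𝔸) χl)).restrictScalars ℝ : Module.End ℝ (SiteY i → 𝔸)) =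
      Y.restrictScalars ℝ * (((η ^ 2) • O).restrictScalars ℝ) * (cutMulY (𝔸 := 𝔸) χl).restrictScalars ℝ := by
    refine LinearMap.ext fun Λ => funext fun z => ?_
    simp only [LinearMap.restrictScalars_apply, LinearMap.smul_apply, LinearMap.comp_apply, Module.End.mul_apply, Pi.smul_apply,
      LinearMap.map_smul_of_tower]
  have eη : ((((η : ℝ) : ℂ))⁻¹ : ℂ) = (((η⁻¹ : ℝ) : ℝ) : ℂ) := by push_cast; rfl
  rw [e1, ← B9Eq352DivFormLetters.conj_mul, mul_assoc, cutMulY_mul_diffLetter_inr, eη, mul_add, B9Thm39CinvTorusRegular.conj_add]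
  simp only [B9Eq352DivFormLetters.conj_mul, conj_cutMulY, conj_smul_cutMulY]
  have e2 : (mulOp fun p : SiteY i × ι => η⁻¹ * (fun z => χl z - χl (shiftY i ν z)) p.1) =
      mulOp (fun p : SiteY i × ι => η⁻¹ * (χl p.1 - χl (shiftY i ν p.1))) := rfl
  noncomm_ring

open Classical in
/-- ★ **COLUMN PIECE 1**: `conj b((η²G′(U₁))^ℝ)·conj b(−η⁻¹∇*_ν)·M_{χl(·+e_ν)}♯ ≺ 𝟙[b′ ∈ S_l]·(M₂Σ‖b_j‖B_G)·ℓ(a)·e^{−δ_Gd}` — entry 2 of (3.42) read off `hE`, the column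
cut-off `|χ_l| ≤ 1` supported within one step of `supp χ_l`. [cite: Balaban1985BackgroundPropagators, Thm 3.1 (3.42) p.397 (third member), (3.100) p.413, p.412 l.22–36; Balaban1984PropagatorsII, (2.51)–(2.52) p.232; Balaban1984PropagatorsI, (1.118) p.36] -/
theorem hasMajorant_colL_G_gradB {BG δG : ℝ} (hE : EBlock (kernelFamilySInv i B cfg O parS) BG δG U₁) (hBG : 0 ≤ BG)
    (ιB : BlkY i → IBondY i) (hι : ∀ s, β i.hN i.D i.hk (ιB s) = s)
    {M₂ : ℝ} (hM₂ : 0 ≤ M₂) (hrepr : ∀ (v : 𝔸) (j : ι), |b.repr v j| ≤ M₂ * ‖v‖) (ν : Fin (d + 1)) :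
    HasMajorant (g := toB6 (geo9K i) Rr Hp) (fun p : SiteY i × ι => ιB (blkOf i.D.toDomains p.1))
      ((conj b (((etaS i ^ 2) • O (cfg U₁)).restrictScalars ℝ) * conj b (diffLetter (shiftY i) (UboxY i (cfg U₁)) (((etaS i : ℝ) : ℂ))⁻¹ (Sum.inr ν))) *
        mulOp (fun p : SiteY i × ι => bumpY i (ctrR i c) (3 * (SC i c : ℝ)) (shiftY i ν p.1)))
      (fun (a b' : (geo9K i).Site) =>
        (if b' ∈ Finset.univ.filter (fun a : (geo9K i).Site => ∃ z : SiteY i, ιB (blkOf i.D.toDomains z) = a ∧ NearC i c (21 * SC i c / 8 + 1) z.1)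
          then (1 : ℝ) else 0) *
        (M₂ * (∑ j, ‖b j‖) * BG * (geo9K i).len a * Real.exp (-(δG * (geo9K i).dist a b')))) := by
  set blk : SiteY i × ι → (geo9K i).Site := fun p => ιB (blkOf i.D.toDomains p.1) with hblk
  have hT := hasMajorant_G_mul_gradB_of_eBlockInv i b cfg O parS (Rr := Rr) (Hp := Hp) hE hBG ιB hι hM₂ hrepr (η := etaS i) rfl
    (Uc := UboxY i (cfg U₁)) rfl (((etaS i ^ 2) • O (cfg U₁)).restrictScalars ℝ) (fun _ => rfl) ν
  refine hasMajorant_mul_mulOp_right (R := Rr) (H := Hp) blk hT _ (fun p => abs_chiL_le_one i c _) _ fun p hne => ?_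
  exact Finset.mem_filter.2 ⟨Finset.mem_univ (α := (geo9K i).Site) _, p.1, rfl, nearC_of_chiL_shiftY_ne_zero i c ν hne⟩

open Classical in
/-- ★ **COLUMN PIECE 2** (the adjoint derivative on the cut-off): `conj b((η²G′(U₁))^ℝ)·M_{η⁻¹(χ_l − χ_l(·+e_ν))}♯ ≺ 𝟙[b′ ∈ S_l]·(M₂Σ‖b_j‖B_G·Λ·D₁θ/3)·ℓ(a)·e^{−(a_G − α)δ₀d}` —
entry 0 of (3.42) (profile `ℓ(a)²` on the ROWS), the one-step size `D₁θ/(3S_j)` on the COLUMNS, so one of the two lengths `ℓ(a)` is transferred to the located column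
(`e^{−αδ₀d}ℓ(a) ≤ Λℓ(b′)`, [4] (2.60), hypothesis `hT1`) where `η⁻¹ℓ(b′)/S_j ≤ 1` (`L^{lev} ≤ S_j` near □); rate relaxed to `a_Gδ₀ ≤ δ_G` first.
[cite: Balaban1985BackgroundPropagators, Thm 3.1 (3.42) p.397 (first member), (3.100) p.413, (3.89) p.409, p.398 (remark after (3.47)), p.408; Balaban1984PropagatorsII, (2.51) p.232, Lemma 2.1 (2.60) p.234, (2.1)–(2.2) p.224; Balaban1984PropagatorsI, (1.118) p.36] -/
theorem hasMajorant_colL_G_dchi {BG δG : ℝ} (hE : EBlock (kernelFamilySInv i B cfg O parS) BG δG U₁) (hBG : 0 ≤ BG)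
    (ιB : BlkY i → IBondY i) (hι : ∀ s, β i.hN i.D i.hk (ιB s) = s)
    {M₂ : ℝ} (hM₂ : 0 ≤ M₂) (hrepr : ∀ (v : 𝔸) (j : ι), |b.repr v j| ≤ M₂ * ‖v‖) (hη : etaS i = |i.cf|⁻¹) (ν : Fin (d + 1))
    {δ₀ aG α Λ : ℝ} (haG : aG * δ₀ ≤ δG) (hΛ : 0 ≤ Λ)
    (hT1 : ScaleTransfer (geo9K i) δ₀ α Λ (fun a => (geo9K i).len a)) :
    HasMajorant (g := toB6 (geo9K i) Rr Hp) (fun p : SiteY i × ι => ιB (blkOf i.D.toDomains p.1))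
      (conj b (((etaS i ^ 2) • O (cfg U₁)).restrictScalars ℝ) *
        mulOp (fun p : SiteY i × ι => (etaS i)⁻¹ * (bumpY i (ctrR i c) (3 * (SC i c : ℝ)) p.1 - bumpY i (ctrR i c) (3 * (SC i c : ℝ)) (shiftY i ν p.1))))
      (fun (a b' : (geo9K i).Site) =>
        (if b' ∈ Finset.univ.filter (fun a : (geo9K i).Site => ∃ z : SiteY i, ιB (blkOf i.D.toDomains z) = a ∧ NearC i c (21 * SC i c / 8 + 1) z.1)
          then (1 : ℝ) else 0) *
        (M₂ * (∑ j, ‖b j‖) * BG * Λ * (D1 thetaProf / 3) * (geo9K i).len a * Real.exp (-((aG - α) * δ₀ * (geo9K i).dist a b')))) := by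
  set blk : SiteY i × ι → (geo9K i).Site := fun p => ιB (blkOf i.D.toDomains p.1) with hblk
  set SL : Finset (geo9K i).Site :=
    Finset.univ.filter (fun a : (geo9K i).Site => ∃ z : SiteY i, ιB (blkOf i.D.toDomains z) = a ∧ NearC i c (21 * SC i c / 8 + 1) z.1) with hSL
  have hT := hasMajorant_conj_G_of_eBlockInv i b cfg O parS (Rr := Rr) (Hp := Hp) hE hBG ιB hι hM₂ hrepr (η := etaS i) rfl
    (((etaS i ^ 2) • O (cfg U₁)).restrictScalars ℝ) (fun _ => rfl)
  obtain ⟨-, hsymm, hdnn⟩ := geo9K_axioms i Rr Hp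
  have hS1 := one_le_SC i c
  have hS : (0 : ℝ) < (SC i c : ℝ) := by exact_mod_cast (show (0 : ℤ) < SC i c by linarith)
  have hηpos : 0 < etaS i := etaS_pos i
  have hD1 : 0 ≤ D1 thetaProf := D1_nonneg contDiff_thetaProf hasCompactSupport_thetaProf
  have hSb : 0 ≤ ∑ j, ‖b j‖ := Finset.sum_nonneg fun _ _ => norm_nonneg _
  have hlen0 : ∀ y : (geo9K i).Site, 0 ≤ (geo9K i).len y := fun y => (B6KLevelCensusIndexV1.len_pos i y).le
  -- the column multiplier is bounded by the column weight `𝟙[b′ ∈ S_l]·η⁻¹·D₁θ/(3S_j)`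
  have hwnn : ∀ y : (geo9K i).Site, 0 ≤ (if y ∈ SL then (etaS i)⁻¹ * (D1 thetaProf / (3 * (SC i c : ℝ))) else 0) := fun y => by
    split_ifs <;> positivity
  have hf : ∀ p : SiteY i × ι,
      |(etaS i)⁻¹ * (bumpY i (ctrR i c) (3 * (SC i c : ℝ)) p.1 - bumpY i (ctrR i c) (3 * (SC i c : ℝ)) (shiftY i ν p.1))| ≤
        (if blk p ∈ SL then (etaS i)⁻¹ * (D1 thetaProf / (3 * (SC i c : ℝ))) else 0) := by
    intro p
    by_cases h0 : bumpY i (ctrR i c) (3 * (SC i c : ℝ)) p.1 - bumpY i (ctrR i c) (3 * (SC i c : ℝ)) (shiftY i ν p.1) = 0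
    · rw [h0, mul_zero, abs_zero]; exact hwnn _
    · have hmem : blk p ∈ SL := by
        by_cases h1 : bumpY i (ctrR i c) (3 * (SC i c : ℝ)) p.1 = 0
        · have h2 : bumpY i (ctrR i c) (3 * (SC i c : ℝ)) (shiftY i ν p.1) ≠ 0 := fun h => h0 (by rw [h, h1, sub_zero])
          exact Finset.mem_filter.2 ⟨Finset.mem_univ (α := (geo9K i).Site) _, p.1, rfl, nearC_of_chiL_shiftY_ne_zero i c ν h2⟩
        · exact Finset.mem_filter.2 ⟨Finset.mem_univ (α := (geo9K i).Site) _, p.1, rfl, (nearC_of_chiL_ne_zero i c h1).mono i c (by linarith)⟩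
      show _ ≤ (if blk p ∈ SL then (etaS i)⁻¹ * (D1 thetaProf / (3 * (SC i c : ℝ))) else 0)
      rw [if_pos hmem, abs_mul, abs_of_pos (inv_pos.2 hηpos), ← abs_neg, neg_sub]
      exact mul_le_mul_of_nonneg_left (abs_chiL_shiftY_sub_le i c ν p.1) (inv_pos.2 hηpos).le
  have hw := hasMajorant_mul_mulOp_right_weight (R := Rr) (H := Hp) blk hT _
    (fun y : (geo9K i).Site => if y ∈ SL then (etaS i)⁻¹ * (D1 thetaProf / (3 * (SC i c : ℝ))) else 0) hwnn hf
  refine hasMajorant_mono (g := toB6 (geo9K i) Rr Hp) _ hw fun (a b' : (geo9K i).Site) => ?_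
  show M₂ * (∑ j, ‖b j‖) * BG * (geo9K i).len a ^ 2 * Real.exp (-(δG * (geo9K i).dist a b')) *
      (if b' ∈ SL then (etaS i)⁻¹ * (D1 thetaProf / (3 * (SC i c : ℝ))) else 0) ≤
    (if b' ∈ SL then (1 : ℝ) else 0) * (M₂ * (∑ j, ‖b j‖) * BG * Λ * (D1 thetaProf / 3) * (geo9K i).len a *
      Real.exp (-((aG - α) * δ₀ * (geo9K i).dist a b')))
  by_cases hb' : b' ∈ SL
  · obtain ⟨z, hzb, hz⟩ := (Finset.mem_filter.1 hb').2
    rw [if_pos hb', if_pos hb', one_mul]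
    -- `ℓ(b′) = L^{lev z}·η ≤ S_j·η`
    have hlenb : (geo9K i).len b' ≤ (SC i c : ℝ) * etaS i := by
      rw [← hzb, geo9K_len_site i ιB hι z, show (kGeo i).eta = |i.cf|⁻¹ from rfl, ← hη]
      have h := pow_levY_le_SC i c (r := 21 * SC i c / 8 + 1) (by omega) hz
      have h' : ((((ℓ + 1) ^ levY i z : ℕ) : ℤ) : ℝ) ≤ ((SC i c : ℤ) : ℝ) := by exact_mod_cast h
      push_cast at h'
      exact mul_le_mul_of_nonneg_right h' hηpos.le
    -- the transfer of one `ℓ`: `e^{−αδ₀d(a,b′)}·ℓ(a) ≤ Λ·ℓ(b′)` (ScaleTransfer at `(b′, a)`, `d` symmetric)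
    have htr : Real.exp (-(α * δ₀ * (geo9K i).dist a b')) * (geo9K i).len a ≤ Λ * (geo9K i).len b' := by
      rw [hsymm a b']; exact hT1 b' a
    -- the rate: `δ_G ≥ a_Gδ₀ = (a_G − α)δ₀ + αδ₀`
    have hrate : Real.exp (-(δG * (geo9K i).dist a b')) ≤
        Real.exp (-((aG - α) * δ₀ * (geo9K i).dist a b')) * Real.exp (-(α * δ₀ * (geo9K i).dist a b')) := by
      rw [← Real.exp_add]
      exact Real.exp_le_exp.2 (by nlinarith [hdnn a b'])
    have hC0 : 0 ≤ M₂ * (∑ j, ‖b j‖) * BG := by positivity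
    calc M₂ * (∑ j, ‖b j‖) * BG * (geo9K i).len a ^ 2 * Real.exp (-(δG * (geo9K i).dist a b')) * ((etaS i)⁻¹ * (D1 thetaProf / (3 * (SC i c : ℝ))))
        ≤ M₂ * (∑ j, ‖b j‖) * BG * (geo9K i).len a ^ 2 *
            (Real.exp (-((aG - α) * δ₀ * (geo9K i).dist a b')) * Real.exp (-(α * δ₀ * (geo9K i).dist a b'))) *
            ((etaS i)⁻¹ * (D1 thetaProf / (3 * (SC i c : ℝ)))) := by
          refine mul_le_mul_of_nonneg_right (mul_le_mul_of_nonneg_left hrate (by positivity)) (by positivity)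
      _ = M₂ * (∑ j, ‖b j‖) * BG * (D1 thetaProf / 3) * (geo9K i).len a * Real.exp (-((aG - α) * δ₀ * (geo9K i).dist a b')) *
            ((Real.exp (-(α * δ₀ * (geo9K i).dist a b')) * (geo9K i).len a) * ((etaS i)⁻¹ / (SC i c : ℝ))) := by
          field_simp
      _ ≤ M₂ * (∑ j, ‖b j‖) * BG * (D1 thetaProf / 3) * (geo9K i).len a * Real.exp (-((aG - α) * δ₀ * (geo9K i).dist a b')) *
            ((Λ * (geo9K i).len b') * ((etaS i)⁻¹ / (SC i c : ℝ))) := by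
          refine mul_le_mul_of_nonneg_left (mul_le_mul_of_nonneg_right htr (by positivity)) ?_
          exact mul_nonneg (mul_nonneg (mul_nonneg hC0 (by positivity)) (hlen0 a)) (Real.exp_nonneg _)
      _ ≤ M₂ * (∑ j, ‖b j‖) * BG * (D1 thetaProf / 3) * (geo9K i).len a * Real.exp (-((aG - α) * δ₀ * (geo9K i).dist a b')) * (Λ * 1) := by
          refine mul_le_mul_of_nonneg_left ?_ ?_
          · rw [mul_assoc]
            refine mul_le_mul_of_nonneg_left ?_ hΛ
            rw [← mul_div_assoc, div_le_one (by positivity), mul_comm]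
            calc (etaS i)⁻¹ * (geo9K i).len b' ≤ (etaS i)⁻¹ * ((SC i c : ℝ) * etaS i) := mul_le_mul_of_nonneg_left hlenb (inv_pos.2 hηpos).le
              _ = (SC i c : ℝ) := by field_simp
          · exact mul_nonneg (mul_nonneg (mul_nonneg hC0 (by positivity)) (hlen0 a)) (Real.exp_nonneg _)
      _ = _ := by ring
  · rw [if_neg hb', if_neg hb', mul_zero, zero_mul]

end Cols

/-! ## §3  The COLUMNS of the commutator `Δ′_□M_χ − M_χΔ′_□` inside `NearC(3S_j − 2L^{j+1})` vanish (p21 D3's plateau, column version) -/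

section Plateau

open Classical in
/-- ★ **THE COLUMNS OF `[M_χ, Δ′_{a,□}(V)]` INSIDE `NearC(3S_j − 2L^{j+1})` VANISH**: inserting the column cut-off `𝟙[¬NearC(3S_j − 2L^{j+1})]` changes nothing — a row `z`
whose stencil meets such a column lies in the plateau `NearC(3S_j − L^{j+1})`, where the row vanishes (p21 D3), and otherwise the input is unchanged on the stencil.
[cite: Balaban1985BackgroundPropagators, (3.88) p.409, p.412 l.1–9; Balaban1984PropagatorsI, (1.118) p.36] -/
theorem comm_cutMulY_chiY_apply_colCut (par : SiteParY 𝔸 i) (V : CfgY 𝔸 i) (X : SiteY i → 𝔸) (z : SiteY i) :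
    ((cutMulY (chiY i c) * deltaPrimeACubeY i c par V - deltaPrimeACubeY i c par V * cutMulY (chiY i c) : Module.End ℂ (SiteY i → 𝔸))
        (cutMulY (𝔸 := 𝔸) (fun w : SiteY i => if NearC i c (3 * SC i c - 2 * (bS i c : ℤ)) w.1 then (0 : ℝ) else 1) X)) z =
      ((cutMulY (chiY i c) * deltaPrimeACubeY i c par V - deltaPrimeACubeY i c par V * cutMulY (chiY i c) : Module.End ℂ (SiteY i → 𝔸)) X) z := by
  by_cases hz : NearC i c (3 * SC i c - (bS i c : ℤ)) z.1
  · rw [comm_cutMulY_chiY_apply_eq_zero_of_nearC i c par V _ hz, comm_cutMulY_chiY_apply_eq_zero_of_nearC i c par V _ hz]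
  · -- the cut input agrees with `X` on the stencil of `z`
    have h8 := eight_mul_bS_le_SC i c
    have hS := one_le_SC i c
    have hag : ∀ w ∈ stencilY i z, cutMulY (𝔸 := 𝔸) (fun w : SiteY i => if NearC i c (3 * SC i c - 2 * (bS i c : ℤ)) w.1 then (0 : ℝ) else 1) X w = X w := by
      intro w hw
      rw [cutMulY_apply]
      by_cases hwn : NearC i c (3 * SC i c - 2 * (bS i c : ℤ)) w.1
      · exact absurd ((nearC_of_mem_stencilY_rev' i c (by linarith) hwn hw).mono i c (by linarith)) hz
      · rw [if_neg hwn, Complex.ofReal_one, one_smul]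
    have hag' : ∀ w ∈ stencilY i z, cutMulY (chiY i c) (cutMulY (𝔸 := 𝔸) (fun w : SiteY i => if NearC i c (3 * SC i c - 2 * (bS i c : ℤ)) w.1 then (0 : ℝ) else 1) X) w =
        cutMulY (chiY i c) X w := fun w hw => by rw [cutMulY_apply, hag w hw, cutMulY_apply]
    rw [LinearMap.sub_apply, LinearMap.sub_apply, Pi.sub_apply, Pi.sub_apply, Module.End.mul_apply, Module.End.mul_apply, Module.End.mul_apply,
      Module.End.mul_apply, cutMulY_apply, cutMulY_apply, deltaPrimeACubeY_apply_congr_stencil i c par V z hag,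
      deltaPrimeACubeY_apply_congr_stencil i c par V z hag']

open Classical in
/-- hence `G′_□(V′)·(Δ′_□M_χ − M_χΔ′_□) = G′_□(V′)·(Δ′_□M_χ − M_χΔ′_□)·M_{𝟙[¬NearC(3S_j − 2L^{j+1})]}` and, conjugated, the cube letter of the `hDR` commutator piece
carries the column cut-off for free. [cite: Balaban1985BackgroundPropagators, (3.88) p.409, p.412 l.1–9] -/
theorem conj_GK_eq_mul_mulOp_colCut (parS : SiteParY 𝔸 i) (V' : CfgY 𝔸 i) :
    conj b (((GpCubeY i c parS V' * (deltaPrimeACubeY i c parS V' * cutMulY (𝔸 := 𝔸) (chiY i c) - cutMulY (𝔸 := 𝔸) (chiY i c) * deltaPrimeACubeY i c parS V')).restrictScalars ℝ :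
        Module.End ℝ (SiteY i → 𝔸))) =
      conj b (((GpCubeY i c parS V' * (deltaPrimeACubeY i c parS V' * cutMulY (𝔸 := 𝔸) (chiY i c) - cutMulY (𝔸 := 𝔸) (chiY i c) * deltaPrimeACubeY i c parS V')).restrictScalars ℝ :
        Module.End ℝ (SiteY i → 𝔸))) *
        mulOp (fun p : SiteY i × ι => if NearC i c (3 * SC i c - 2 * (bS i c : ℤ)) p.1.1 then (0 : ℝ) else 1) := by
  set K : Module.End ℂ (SiteY i → 𝔸) :=
    cutMulY (𝔸 := 𝔸) (chiY i c) * deltaPrimeACubeY i c parS V' - deltaPrimeACubeY i c parS V' * cutMulY (𝔸 := 𝔸) (chiY i c) with hK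
  have eK : deltaPrimeACubeY i c parS V' * cutMulY (𝔸 := 𝔸) (chiY i c) - cutMulY (𝔸 := 𝔸) (chiY i c) * deltaPrimeACubeY i c parS V' = -K := by
    rw [hK, neg_sub]
  have hcol : ∀ (X : SiteY i → 𝔸) (z : SiteY i),
      ((-K) (cutMulY (𝔸 := 𝔸) (fun w : SiteY i => if NearC i c (3 * SC i c - 2 * (bS i c : ℤ)) w.1 then (0 : ℝ) else 1) X)) z = ((-K) X) z :=
    fun X z => by rw [LinearMap.neg_apply, LinearMap.neg_apply, Pi.neg_apply, Pi.neg_apply, comm_cutMulY_chiY_apply_colCut]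
  have hop : ((GpCubeY i c parS V' * -K).restrictScalars ℝ : Module.End ℝ (SiteY i → 𝔸)) =
      ((GpCubeY i c parS V' * -K).restrictScalars ℝ : Module.End ℝ (SiteY i → 𝔸)) *
        (cutMulY (𝔸 := 𝔸) (fun w : SiteY i => if NearC i c (3 * SC i c - 2 * (bS i c : ℤ)) w.1 then (0 : ℝ) else 1)).restrictScalars ℝ := by
    refine LinearMap.ext fun X => ?_
    rw [Module.End.mul_apply, LinearMap.restrictScalars_apply, LinearMap.restrictScalars_apply, LinearMap.restrictScalars_apply,
      Module.End.mul_apply, Module.End.mul_apply]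
    congr 1
    exact funext fun z => (hcol X z).symm
  conv_lhs => rw [eK, hop, B9Eq352DivFormLetters.conj_mul, conj_cutMulY]
  rw [eK]

/-- the collar separation for the column plateau's complement: `NearC(21S_j/8 + 1)` vs `¬NearC(3S_j − 2L^{j+1})`: `3M_h/8 − 3 ≤ d` (`M_h·L^{j+1} = S_j`).
[cite: Balaban1985BackgroundPropagators, p.412 l.31–36, (3.63) p.402; Balaban1984PropagatorsII, (2.46) p.231] -/
theorem collar_le_dist_chiL_annulus2 (ιB : BlkY i → IBondY i) (hι : ∀ s, β i.hN i.D i.hk (ιB s) = s) {z w : SiteY i}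
    (hz : NearC i c (21 * SC i c / 8 + 1) z.1) (hw : ¬ NearC i c (3 * SC i c - 2 * (bS i c : ℤ)) w.1) :
    3 / 8 * (i.Mh : ℝ) - 3 ≤ (geo9K i).dist (ιB (blkOf i.D.toDomains z)) (ιB (blkOf i.D.toDomains w)) := by
  have hbS0 : (0 : ℤ) ≤ (bS i c : ℤ) := by positivity
  have key := collar_le_dist_of_nearC_of_not_nearC i c ιB hι (r₂ := 3 * SC i c - 2 * (bS i c : ℤ)) (by linarith) hz hw
  have hS1 := one_le_SC i c
  have hS : (0 : ℝ) < (SC i c : ℝ) := by exact_mod_cast (show (0 : ℤ) < SC i c by omega)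
  have hMh : (0 : ℝ) ≤ (i.Mh : ℝ) := by positivity
  have hSC : (SC i c : ℝ) = (i.Mh : ℝ) * (bS i c : ℝ) := by
    have h' : (SC i c : ℤ) = ((i.Mh * (ℓ + 1) ^ (c.1.1 + 1) : ℕ) : ℤ) := rfl
    rw [h']
    unfold bS; push_cast; ring
  have hgap : 3 * (SC i c : ℝ) - 16 * (bS i c : ℝ) ≤ 8 * (((3 * SC i c - 2 * (bS i c : ℤ) + 1 - (21 * SC i c / 8 + 1) : ℤ) : ℝ)) := by
    have h8 : 8 * (21 * SC i c / 8) ≤ 21 * SC i c := Int.mul_ediv_self_le (by norm_num)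
    have : 3 * SC i c - 16 * (bS i c : ℤ) ≤ 8 * (3 * SC i c - 2 * (bS i c : ℤ) + 1 - (21 * SC i c / 8 + 1)) := by omega
    have h' : ((3 * SC i c - 16 * (bS i c : ℤ) : ℤ) : ℝ) ≤ ((8 * (3 * SC i c - 2 * (bS i c : ℤ) + 1 - (21 * SC i c / 8 + 1)) : ℤ) : ℝ) :=
      Int.cast_le.mpr this
    have e1 : ((3 * SC i c - 16 * (bS i c : ℤ) : ℤ) : ℝ) = 3 * (SC i c : ℝ) - 16 * (bS i c : ℝ) := by push_cast; ring
    have e2 : ((8 * (3 * SC i c - 2 * (bS i c : ℤ) + 1 - (21 * SC i c / 8 + 1)) : ℤ) : ℝ) =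
        8 * (((3 * SC i c - 2 * (bS i c : ℤ) + 1 - (21 * SC i c / 8 + 1) : ℤ) : ℝ)) := by
      push_cast; ring
    rw [e1, e2] at h'
    exact h'
  have hmono : 3 / 8 * (i.Mh : ℝ) - 2 ≤ (i.Mh : ℝ) * (((3 * SC i c - 2 * (bS i c : ℤ) + 1 - (21 * SC i c / 8 + 1) : ℤ) : ℝ)) / (SC i c : ℝ) := by
    rw [le_div_iff₀ hS]
    have e : (3 / 8 * (i.Mh : ℝ) - 2) * (SC i c : ℝ) = (i.Mh : ℝ) * ((3 * (SC i c : ℝ) - 16 * (bS i c : ℝ)) / 8) := by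
      rw [hSC]; ring
    rw [e]
    have : (3 * (SC i c : ℝ) - 16 * (bS i c : ℝ)) / 8 ≤ (((3 * SC i c - 2 * (bS i c : ℤ) + 1 - (21 * SC i c / 8 + 1) : ℤ) : ℝ)) := by linarith
    exact mul_le_mul_of_nonneg_left this hMh
  linarith

end Plateau

/-! ## §4  The GAP PIECE `(1 − M_{χ_□})·G′(U₁)·M_χl·(−∇*_ν)`: rows where `χ_□ ≠ 1`, columns in the collar of `χ_l` -/

section GapR

variable [Fintype (geo9K i).Site] [DecidableEq (geo9K i).Site] {Rr : ℝ} {Hp : Prop}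
variable {B : B9.Backgrounds} (cfg : B.Cfg → CfgY 𝔸 i) (O : SiteOpY 𝔸 i) (parS : SiteParY 𝔸 i) {U₁ : B.Cfg}

open Classical in
set_option maxHeartbeats 1600000 in
/-- ★★ **THE RIGHT GAP PIECE IS EXPONENTIALLY SMALL IN THE COLLAR**:
`conj b((η²·(1 − M_{χ_□})·G′(U₁)·M_χl)^ℝ)·conj b(−η⁻¹∇*_ν) ≺ 𝟙[b′ ∈ S_l]·(M₂Σ‖b_j‖B_G(1 + ΛD₁θ/3)·e^{−a_sepδ₀(3M_h/8 − 1)})·ℓ(a)·e^{−ρδ₀d}` (`α + a_sep + ρ ≤ a_G`, `a_Gδ₀ ≤ δ_G`):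
the mirrored (3.100) split, the two column pieces (§2), the row cut-off `1 − χ_□` over blocks `≥ 3M_h/8 − 1` away from the located columns (F3-E2a), `colSep_majorant_blk`.
[cite: Balaban1985BackgroundPropagators, p.412 l.22–36, p.415 l.29–31, (3.100) p.413, Thm 3.1 (3.42) p.397; Balaban1983RegularityDecay, (1.11)–(1.12) (statement type); Balaban1984PropagatorsII, (2.83)–(2.85) pp.237–238, (2.60) p.234] -/
theorem hasMajorant_gapPieceR {BG δG : ℝ} (hE : EBlock (kernelFamilySInv i B cfg O parS) BG δG U₁) (hBG : 0 ≤ BG)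
    (ιB : BlkY i → IBondY i) (hι : ∀ s, β i.hN i.D i.hk (ιB s) = s)
    {M₂ : ℝ} (hM₂ : 0 ≤ M₂) (hrepr : ∀ (v : 𝔸) (j : ι), |b.repr v j| ≤ M₂ * ‖v‖) (hη : etaS i = |i.cf|⁻¹) (ν : Fin (d + 1))
    {δ₀ aG α Λ asep ρ : ℝ} (hδ₀ : 0 ≤ δ₀) (haG : aG * δ₀ ≤ δG) (hα : 0 ≤ α) (hΛ : 0 ≤ Λ)
    (hT1 : ScaleTransfer (geo9K i) δ₀ α Λ (fun a => (geo9K i).len a)) (hasep : 0 ≤ asep) (hsplit : α + asep + ρ ≤ aG) :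
    HasMajorant (g := toB6 (geo9K i) Rr Hp) (fun p : SiteY i × ι => ιB (blkOf i.D.toDomains p.1))
      (conj b (((etaS i ^ 2) • (((1 - cutMulY (𝔸 := 𝔸) (chiY i c)) ∘ₗ O (cfg U₁)) ∘ₗ
          cutMulY (𝔸 := 𝔸) (bumpY i (ctrR i c) (3 * (SC i c : ℝ))))).restrictScalars ℝ) *
        conj b (diffLetter (shiftY i) (UboxY i (cfg U₁)) (((etaS i : ℝ) : ℂ))⁻¹ (Sum.inr ν)))
      (fun (a a' : (geo9K i).Site) =>
        (if a' ∈ Finset.univ.filter (fun a : (geo9K i).Site => ∃ z : SiteY i, ιB (blkOf i.D.toDomains z) = a ∧ NearC i c (21 * SC i c / 8 + 1) z.1)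
          then (1 : ℝ) else 0) *
        ((M₂ * (∑ j, ‖b j‖) * BG * (1 + Λ * (D1 thetaProf / 3)) * Real.exp (-(asep * δ₀ * (3 / 8 * (i.Mh : ℝ) - 1)))) * (geo9K i).len a *
          Real.exp (-(ρ * δ₀ * (geo9K i).dist a a')))) := by
  set blk : SiteY i × ι → (geo9K i).Site := fun p => ιB (blkOf i.D.toDomains p.1) with hblk
  set χl : SiteY i → ℝ := bumpY i (ctrR i c) (3 * (SC i c : ℝ)) with hχl
  set SL : Finset (geo9K i).Site :=
    Finset.univ.filter (fun a : (geo9K i).Site => ∃ z : SiteY i, ιB (blkOf i.D.toDomains z) = a ∧ NearC i c (21 * SC i c / 8 + 1) z.1) with hSL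
  set ZY : Finset (geo9K i).Site :=
    Finset.univ.filter (fun a : (geo9K i).Site => ∃ w : SiteY i, ιB (blkOf i.D.toDomains w) = a ∧ chiY i c w ≠ 1) with hZY
  obtain ⟨-, hsymm, hdnn⟩ := geo9K_axioms i Rr Hp
  have hSb : 0 ≤ ∑ j, ‖b j‖ := Finset.sum_nonneg fun _ _ => norm_nonneg _
  have hD1 : 0 ≤ D1 thetaProf := D1_nonneg contDiff_thetaProf hasCompactSupport_thetaProf
  have hlen0 : ∀ y : (geo9K i).Site, 0 ≤ (geo9K i).len y := fun y => (B6KLevelCensusIndexV1.len_pos i y).le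
  rw [conj_cut_gradB_split, conj_one_sub_cutMulY_site, mul_assoc (mulOp _), mul_assoc (mulOp _)]
  -- the row cut-off `1 − χ_□`: `|·| ≤ 1`, supported over `Z_Y`
  have hm1 : ∀ p : SiteY i × ι, |1 - chiY i c p.1| ≤ 1 := fun p => abs_one_sub_chiY_le_one i c p.1
  have hm0 : ∀ p : SiteY i × ι, blk p ∉ ZY → 1 - chiY i c p.1 = 0 := by
    intro p hp
    by_contra hne
    exact hp (Finset.mem_filter.2 ⟨Finset.mem_univ (α := (geo9K i).Site) _, p.1, rfl, fun h1 => hne (by rw [h1, sub_self])⟩)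
  have hsep : ∀ y ∈ ZY, ∀ b' ∈ SL, 3 / 8 * (i.Mh : ℝ) - 1 ≤ (geo9K i).dist y b' := by
    intro y hy b' hb'
    obtain ⟨w, rfl, hw⟩ := (Finset.mem_filter.1 hy).2
    obtain ⟨z, rfl, hz⟩ := (Finset.mem_filter.1 hb').2
    rw [geo9K_dist_comm]
    exact collar_le_dist_chiL_chiY i c ιB hι hz hw
  -- piece 1: rate `δ_G ≥ a_sepδ₀ + ρδ₀`
  have h1 := hasMajorant_colL_G_gradB i c b cfg O parS (Rr := Rr) (Hp := Hp) hE hBG ιB hι hM₂ hrepr ν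
  have hsplit1 : asep * δ₀ + ρ * δ₀ ≤ δG := by nlinarith
  have hG1 := colSep_majorant_blk (R := Rr) (H := Hp) blk (rT := δG) (rsep := asep * δ₀) (rρ := ρ * δ₀) (κ := M₂ * (∑ j, ‖b j‖) * BG)
    (Dsep := 3 / 8 * (i.Mh : ℝ) - 1) (fun a => (geo9K i).len a) SL ZY (fun p : SiteY i × ι => 1 - chiY i c p.1)
    (by positivity) hlen0 (by positivity) hsplit1 hdnn hm1 hm0 hsep h1
  -- piece 2: rate `(a_G − α)δ₀ ≥ a_sepδ₀ + ρδ₀`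
  have h2 := hasMajorant_colL_G_dchi i c b cfg O parS (Rr := Rr) (Hp := Hp) hE hBG ιB hι hM₂ hrepr hη ν haG hΛ hT1
  have hsplit2 : asep * δ₀ + ρ * δ₀ ≤ (aG - α) * δ₀ := by nlinarith
  have hG2 := colSep_majorant_blk (R := Rr) (H := Hp) blk (rT := (aG - α) * δ₀) (rsep := asep * δ₀) (rρ := ρ * δ₀)
    (κ := M₂ * (∑ j, ‖b j‖) * BG * Λ * (D1 thetaProf / 3)) (Dsep := 3 / 8 * (i.Mh : ℝ) - 1) (fun a => (geo9K i).len a) SL ZY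
    (fun p : SiteY i × ι => 1 - chiY i c p.1) (by positivity) hlen0 (by positivity) hsplit2 hdnn hm1 hm0 hsep h2
  refine hasMajorant_mono (g := toB6 (geo9K i) Rr Hp) _ (hasMajorant_add (g := toB6 (geo9K i) Rr Hp) _ hG1 hG2) fun (a a' : (geo9K i).Site) => ?_
  have hla := hlen0 a
  show (if a' ∈ SL then (1 : ℝ) else 0) * _ + (if a' ∈ SL then (1 : ℝ) else 0) * _ ≤ (if a' ∈ SL then (1 : ℝ) else 0) * _
  by_cases ha' : a' ∈ SL
  · rw [if_pos ha', one_mul, one_mul, one_mul]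
    exact le_of_eq (by ring)
  · rw [if_neg ha', zero_mul, zero_mul, zero_mul, add_zero]

end GapR

/-! ## §5  The COMMUTATOR PIECE `G′_□(V′)·(Δ′_□M_{χ_□} − M_{χ_□}Δ′_□)·G′(U₁)·M_χl·(−∇*_ν)`: cube letter LEFT (displayed kernel `hGK`), member word right -/

section CommR

variable [Fintype (geo9K i).Site] [DecidableEq (geo9K i).Site] {Rr : ℝ} {Hp : Prop}
variable {B : B9.Backgrounds} (cfg : B.Cfg → CfgY 𝔸 i) (O : SiteOpY 𝔸 i) (parS : SiteParY 𝔸 i) {U₁ : B.Cfg}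

open Classical in
set_option maxHeartbeats 1600000 in
/-- ★★ **THE RIGHT COMMUTATOR PIECE IS EXPONENTIALLY SMALL IN THE COLLAR, MODULO THE CUBE LETTER'S KERNEL `hGK`**: with
`T_χ = G′_□(V′)·(Δ′_□(V′)M_{χ_□} − M_{χ_□}Δ′_□(V′))` and its member-carrier kernel `conj b(T_χ^ℝ) ≺ θ_K·e^{−b_Kδ₀d}` DISPLAYED (global rows and columns; supplier:
p21 D3∕D4 on the cube carrier at the datum + p38 `B9Cor36SiteSandwichTransfer` ∕ g58),
`conj b((η²·T_χ·G′(U₁)·M_χl)^ℝ)·conj b(−η⁻¹∇*_ν) ≺ 𝟙[b′ ∈ S_l]·(M₂Σ‖b_j‖B_G(1 + ΛD₁θ/3)·θ_K·Λ_st·c₁(δ₀, a_G − α − a_sep − ρ)·e^{−a_sepδ₀(3M_h/8 − 3)})·ℓ(a)·e^{−ρδ₀d}`: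
the columns of `T_χ` lie outside `NearC(3S_j − 2L^{j+1})` for free (§3), at distance `≥ 3M_h/8 − 3` from the located columns `S_l`; `sepLeftCol_majorant_blk` ([4] (2.83) with
the separation in the middle, one length `ℓ(y″)` transferred to the row by `hTst`, the member (2.61)).
[cite: Balaban1985BackgroundPropagators, p.412 l.1–9 + l.22–36, p.415 l.29–31, (3.88)–(3.89) p.409, (3.97) p.412, (3.100) p.413, Thm 3.1 (3.42) p.397; Balaban1984PropagatorsII, (2.83)–(2.85) pp.237–238, Lemma 2.1 (2.60)–(2.61) p.234; Balaban1983RegularityDecay, (1.11)–(1.12) (statement type)] -/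
theorem hasMajorant_commPieceR {BG δG : ℝ} (hE : EBlock (kernelFamilySInv i B cfg O parS) BG δG U₁) (hBG : 0 ≤ BG)
    (ιB : BlkY i → IBondY i) (hι : ∀ s, β i.hN i.D i.hk (ιB s) = s)
    {M₂ : ℝ} (hM₂ : 0 ≤ M₂) (hrepr : ∀ (v : 𝔸) (j : ι), |b.repr v j| ≤ M₂ * ‖v‖) (hη : etaS i = |i.cf|⁻¹) (ν : Fin (d + 1))
    (V' : CfgY 𝔸 i) (dB : ℕ) {δ₀ aG α Λ θK bK αst Λst asep ρ : ℝ} (hδ₀ : 0 ≤ δ₀) (haG : aG * δ₀ ≤ δG) (hα : 0 ≤ α) (hΛ : 0 ≤ Λ)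
    (hT1 : ScaleTransfer (geo9K i) δ₀ α Λ (fun a => (geo9K i).len a)) (hθK : 0 ≤ θK) (hΛst : 0 ≤ Λst)
    (hTst : ScaleTransfer (geo9K i) δ₀ αst Λst (fun a => (geo9K i).len a)) (hasep : 0 ≤ asep) (hρ : 0 ≤ ρ) (hsplitL : αst + ρ ≤ bK)
    (h261 : Ineq261 dB (toB6 (geo9K i) Rr Hp) δ₀ (aG - α - asep - ρ))
    (hGK : HasMajorant (g := toB6 (geo9K i) Rr Hp) (fun p : SiteY i × ι => ιB (blkOf i.D.toDomains p.1))
      (conj b (((GpCubeY i c parS V' * (deltaPrimeACubeY i c parS V' * cutMulY (𝔸 := 𝔸) (chiY i c) -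
          cutMulY (𝔸 := 𝔸) (chiY i c) * deltaPrimeACubeY i c parS V')).restrictScalars ℝ : Module.End ℝ (SiteY i → 𝔸))))
      (fun (a y'' : (geo9K i).Site) => θK * Real.exp (-(bK * δ₀ * (geo9K i).dist a y'')))) :
    HasMajorant (g := toB6 (geo9K i) Rr Hp) (fun p : SiteY i × ι => ιB (blkOf i.D.toDomains p.1))
      (conj b (((etaS i ^ 2) • (((GpCubeY i c parS V' * (deltaPrimeACubeY i c parS V' * cutMulY (𝔸 := 𝔸) (chiY i c) -
          cutMulY (𝔸 := 𝔸) (chiY i c) * deltaPrimeACubeY i c parS V')) ∘ₗ O (cfg U₁)) ∘ₗ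
          cutMulY (𝔸 := 𝔸) (bumpY i (ctrR i c) (3 * (SC i c : ℝ))))).restrictScalars ℝ) *
        conj b (diffLetter (shiftY i) (UboxY i (cfg U₁)) (((etaS i : ℝ) : ℂ))⁻¹ (Sum.inr ν)))
      (fun (a a' : (geo9K i).Site) =>
        (if a' ∈ Finset.univ.filter (fun a : (geo9K i).Site => ∃ z : SiteY i, ιB (blkOf i.D.toDomains z) = a ∧ NearC i c (21 * SC i c / 8 + 1) z.1)
          then (1 : ℝ) else 0) *
        ((M₂ * (∑ j, ‖b j‖) * BG * (1 + Λ * (D1 thetaProf / 3)) * θK * Λst * B6.c1 dB δ₀ (aG - α - asep - ρ) *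
            Real.exp (-(asep * δ₀ * (3 / 8 * (i.Mh : ℝ) - 3)))) * (geo9K i).len a * Real.exp (-(ρ * δ₀ * (geo9K i).dist a a')))) := by
  set blk : SiteY i × ι → (geo9K i).Site := fun p => ιB (blkOf i.D.toDomains p.1) with hblk
  set χl : SiteY i → ℝ := bumpY i (ctrR i c) (3 * (SC i c : ℝ)) with hχl
  set SL : Finset (geo9K i).Site :=
    Finset.univ.filter (fun a : (geo9K i).Site => ∃ z : SiteY i, ιB (blkOf i.D.toDomains z) = a ∧ NearC i c (21 * SC i c / 8 + 1) z.1) with hSL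
  set ZA : Finset (geo9K i).Site :=
    Finset.univ.filter (fun a : (geo9K i).Site => ∃ w : SiteY i, ιB (blkOf i.D.toDomains w) = a ∧ ¬ NearC i c (3 * SC i c - 2 * (bS i c : ℤ)) w.1) with hZA
  obtain ⟨htri, hsymm, hdnn⟩ := geo9K_axioms i Rr Hp
  have hSb : 0 ≤ ∑ j, ‖b j‖ := Finset.sum_nonneg fun _ _ => norm_nonneg _
  have hD1 : 0 ≤ D1 thetaProf := D1_nonneg contDiff_thetaProf hasCompactSupport_thetaProf
  have hlen0 : ∀ y : (geo9K i).Site, 0 ≤ (geo9K i).len y := fun y => (B6KLevelCensusIndexV1.len_pos i y).le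
  have hc1 : 0 ≤ B6.c1 dB δ₀ (aG - α - asep - ρ) := c1_nonneg dB δ₀ _
  rw [conj_cut_gradB_split, conj_GK_eq_mul_mulOp_colCut i c b parS V', mul_assoc _ (mulOp _), mul_assoc _ (mulOp _ * _), mul_assoc (mulOp _),
    mul_assoc _ (mulOp _)]
  -- the middle (column-of-`T_χ` = row-of-the-member-word) cut-off
  have hm1 : ∀ p : SiteY i × ι, |(if NearC i c (3 * SC i c - 2 * (bS i c : ℤ)) p.1.1 then (0 : ℝ) else 1)| ≤ 1 := fun p => by
    split_ifs <;> simp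
  have hm0 : ∀ p : SiteY i × ι, blk p ∉ ZA → (if NearC i c (3 * SC i c - 2 * (bS i c : ℤ)) p.1.1 then (0 : ℝ) else 1) = 0 := by
    intro p hp
    by_cases h : NearC i c (3 * SC i c - 2 * (bS i c : ℤ)) p.1.1
    · rw [if_pos h]
    · exact absurd (Finset.mem_filter.2 ⟨Finset.mem_univ (α := (geo9K i).Site) _, p.1, rfl, h⟩) hp
  have hsep : ∀ y'' ∈ ZA, ∀ b' ∈ SL, 3 / 8 * (i.Mh : ℝ) - 3 ≤ (geo9K i).dist y'' b' := by
    intro y hy b' hb'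
    obtain ⟨w, rfl, hw⟩ := (Finset.mem_filter.1 hy).2
    obtain ⟨z, rfl, hz⟩ := (Finset.mem_filter.1 hb').2
    rw [geo9K_dist_comm]
    exact collar_le_dist_chiL_annulus2 i c ιB hι hz hw
  have hST : ∀ a y'' : (geo9K i).Site, Real.exp (-(αst * δ₀ * (geo9K i).dist a y'')) * (geo9K i).len y'' ≤ Λst * (geo9K i).len a :=
    fun a y'' => hTst a y''
  -- piece 1: entry 2, rate relaxed `δ_G → (a_G − α)δ₀`, rows cut to `Z_A`
  have h1 := hasMajorant_colL_G_gradB i c b cfg O parS (Rr := Rr) (Hp := Hp) hE hBG ιB hι hM₂ hrepr ν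
  have h1' : HasMajorant (g := toB6 (geo9K i) Rr Hp) blk
      ((conj b (((etaS i ^ 2) • O (cfg U₁)).restrictScalars ℝ) * conj b (diffLetter (shiftY i) (UboxY i (cfg U₁)) (((etaS i : ℝ) : ℂ))⁻¹ (Sum.inr ν))) *
        mulOp (fun p : SiteY i × ι => χl (shiftY i ν p.1)))
      (fun (y'' b' : (geo9K i).Site) => (if b' ∈ SL then (1 : ℝ) else 0) *
        (M₂ * (∑ j, ‖b j‖) * BG * (geo9K i).len y'' * Real.exp (-((aG - α) * δ₀ * (geo9K i).dist y'' b')))) := by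
    refine hasMajorant_mono (g := toB6 (geo9K i) Rr Hp) _ h1 fun (y'' b' : (geo9K i).Site) => ?_
    have hly := hlen0 y''
    refine mul_le_mul_of_nonneg_left (mul_le_mul_of_nonneg_left (Real.exp_le_exp.2 ?_) (by positivity)) (by split_ifs <;> norm_num)
    have hr : (aG - α) * δ₀ ≤ δG := by nlinarith [mul_nonneg hα hδ₀]
    have hr' := mul_le_mul_of_nonneg_right hr (hdnn y'' b')
    linarith
  have hR1 := hasMajorant_mulOp_rows (R := Rr) (H := Hp) blk h1' _ hm1 ZA hm0
  have hK1 := sepLeftCol_majorant_blk (R := Rr) (H := Hp) blk dB δ₀ (aG - α) αst asep ρ bK θK (M₂ * (∑ j, ‖b j‖) * BG) Λst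
    (3 / 8 * (i.Mh : ℝ) - 3) (fun a => (geo9K i).len a) (fun a => (geo9K i).len a) SL ZA hθK (by positivity) hΛst hlen0 hlen0 hδ₀ hasep hρ hsplitL
    htri hsymm hdnn hST h261 hsep hGK hR1
  -- piece 2: entry 0 with the cut-off gradient on the columns
  have h2 := hasMajorant_colL_G_dchi i c b cfg O parS (Rr := Rr) (Hp := Hp) hE hBG ιB hι hM₂ hrepr hη ν haG hΛ hT1
  have hR2 := hasMajorant_mulOp_rows (R := Rr) (H := Hp) blk h2 _ hm1 ZA hm0
  have hK2 := sepLeftCol_majorant_blk (R := Rr) (H := Hp) blk dB δ₀ (aG - α) αst asep ρ bK θK (M₂ * (∑ j, ‖b j‖) * BG * Λ * (D1 thetaProf / 3)) Λst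
    (3 / 8 * (i.Mh : ℝ) - 3) (fun a => (geo9K i).len a) (fun a => (geo9K i).len a) SL ZA hθK (by positivity) hΛst hlen0 hlen0 hδ₀ hasep hρ hsplitL
    htri hsymm hdnn hST h261 hsep hGK hR2
  refine hasMajorant_mono (g := toB6 (geo9K i) Rr Hp) _ (hasMajorant_add (g := toB6 (geo9K i) Rr Hp) _ hK1 hK2) fun (a a' : (geo9K i).Site) => ?_
  show (if a' ∈ SL then (1 : ℝ) else 0) * _ + (if a' ∈ SL then (1 : ℝ) else 0) * _ ≤ (if a' ∈ SL then (1 : ℝ) else 0) * _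
  by_cases ha' : a' ∈ SL
  · rw [if_pos ha', one_mul, one_mul, one_mul]
    exact le_of_eq (by ring)
  · rw [if_neg ha', zero_mul, zero_mul, zero_mul, add_zero]

end CommR

/-! ## §6  Assembly: F3-P v2's `hDR □ ν` at `χ := χ_l`, from F3-E1's right identity and the two pieces -/

section AssemblyR

variable [Fintype (geo9K i).Site] [DecidableEq (geo9K i).Site] {Rr : ℝ} {Hp : Prop}
variable {B : B9.Backgrounds} (cfg : B.Cfg → CfgY 𝔸 i) (O : SiteOpY 𝔸 i) (parS : SiteParY 𝔸 i) {U₁ : B.Cfg}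

open Classical in
set_option maxHeartbeats 1600000 in
/-- ★★★ **THE RIGHT-LOCATED `G′`-DIFFERENCE ENTRY `hDR □ ν` OF F3-B ∕ F3-P (v2, at `χ := χ_l`), SUPPLIED MODULO F3-E1's RIGHT IDENTITY `hId` AND THE CUBE LETTER'S
KERNEL `hGK`**: with `Ob = G′_□(V′)`, `T_χ = G′_□(V′)·(Δ′_□(V′)M_{χ_□} − M_{χ_□}Δ′_□(V′))`,
`conj b((η²·(O(U₁) − Ob)·M_χl)^ℝ)·conj b(−η⁻¹∇*_ν(U₁)) ≺ ε_D^R·ℓ(a)·e^{−ρδ₀d}`,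
`ε_D^R = M₂Σ‖b_j‖B_G(1 + ΛD₁θ/3)·(e^{−a_sepδ₀(3M_h/8 − 1)} + θ_KΛ_st·c₁(δ₀, a_G − α − a_sep − ρ)·e^{−a_sepδ₀(3M_h/8 − 3)})` — EXACTLY F3-P v2's `hDR □ ν` shape with `δD = ρδ₀`.
Displayed: `hE`, `hGK`, `hId`, `η = |c_f|⁻¹`, the transfers `hT1`∕`hTst` ([4] (2.60) for `ℓ`), the member (2.61), the budgets `α + a_sep + ρ ≤ a_G`, `a_Gδ₀ ≤ δ_G`, `α_st + ρ ≤ b_K`.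
[cite: Balaban1985BackgroundPropagators, p.415 l.29–31, p.412 l.22–36, (3.97) p.412, (3.100) p.413, (3.88)–(3.89) p.409, Thm 3.1 (3.42) p.397; Balaban1983RegularityDecay, (1.11)–(1.12) (statement type; derivation ours, Theorem-D road); Balaban1984PropagatorsII, (2.83)–(2.85) pp.237–238, Lemma 2.1 (2.60)–(2.61) p.234] -/
theorem hasMajorant_hDR_of_identity {BG δG : ℝ} (hE : EBlock (kernelFamilySInv i B cfg O parS) BG δG U₁) (hBG : 0 ≤ BG)
    (ιB : BlkY i → IBondY i) (hι : ∀ s, β i.hN i.D i.hk (ιB s) = s)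
    {M₂ : ℝ} (hM₂ : 0 ≤ M₂) (hrepr : ∀ (v : 𝔸) (j : ι), |b.repr v j| ≤ M₂ * ‖v‖) (hη : etaS i = |i.cf|⁻¹) (ν : Fin (d + 1))
    (V' : CfgY 𝔸 i) (dB : ℕ) {δ₀ aG α Λ θK bK αst Λst asep ρ : ℝ} (hδ₀ : 0 ≤ δ₀) (haG : aG * δ₀ ≤ δG) (hα : 0 ≤ α) (hΛ : 0 ≤ Λ)
    (hT1 : ScaleTransfer (geo9K i) δ₀ α Λ (fun a => (geo9K i).len a)) (hθK : 0 ≤ θK) (hΛst : 0 ≤ Λst)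
    (hTst : ScaleTransfer (geo9K i) δ₀ αst Λst (fun a => (geo9K i).len a)) (hasep : 0 ≤ asep) (hρ : 0 ≤ ρ) (hsplitL : αst + ρ ≤ bK)
    (hsplit : α + asep + ρ ≤ aG) (h261 : Ineq261 dB (toB6 (geo9K i) Rr Hp) δ₀ (aG - α - asep - ρ))
    (hGK : HasMajorant (g := toB6 (geo9K i) Rr Hp) (fun p : SiteY i × ι => ιB (blkOf i.D.toDomains p.1))
      (conj b (((GpCubeY i c parS V' * (deltaPrimeACubeY i c parS V' * cutMulY (𝔸 := 𝔸) (chiY i c) -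
          cutMulY (𝔸 := 𝔸) (chiY i c) * deltaPrimeACubeY i c parS V')).restrictScalars ℝ : Module.End ℝ (SiteY i → 𝔸))))
      (fun (a y'' : (geo9K i).Site) => θK * Real.exp (-(bK * δ₀ * (geo9K i).dist a y''))))
    (hId : (O (cfg U₁) - GpCubeY i c parS V') * cutMulY (𝔸 := 𝔸) (bumpY i (ctrR i c) (3 * (SC i c : ℝ))) =
      (1 - cutMulY (𝔸 := 𝔸) (chiY i c)) * O (cfg U₁) * cutMulY (𝔸 := 𝔸) (bumpY i (ctrR i c) (3 * (SC i c : ℝ))) +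
        GpCubeY i c parS V' * (deltaPrimeACubeY i c parS V' * cutMulY (𝔸 := 𝔸) (chiY i c) - cutMulY (𝔸 := 𝔸) (chiY i c) * deltaPrimeACubeY i c parS V') *
          O (cfg U₁) * cutMulY (𝔸 := 𝔸) (bumpY i (ctrR i c) (3 * (SC i c : ℝ)))) :
    HasMajorant (g := toB6 (geo9K i) Rr Hp) (fun p : SiteY i × ι => ιB (blkOf i.D.toDomains p.1))
      (conj b (((etaS i ^ 2) • ((O (cfg U₁) - GpCubeY i c parS V') ∘ₗ cutMulY (𝔸 := 𝔸) (bumpY i (ctrR i c) (3 * (SC i c : ℝ))))).restrictScalars ℝ) *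
        conj b (diffLetter (shiftY i) (UboxY i (cfg U₁)) (((etaS i : ℝ) : ℂ))⁻¹ (Sum.inr ν)))
      (fun a a' => (M₂ * (∑ j, ‖b j‖) * BG * (1 + Λ * (D1 thetaProf / 3)) *
          (Real.exp (-(asep * δ₀ * (3 / 8 * (i.Mh : ℝ) - 1))) +
            θK * Λst * B6.c1 dB δ₀ (aG - α - asep - ρ) * Real.exp (-(asep * δ₀ * (3 / 8 * (i.Mh : ℝ) - 3))))) *
        (geo9K i).len a * Real.exp (-(ρ * δ₀ * (geo9K i).dist a a'))) := by
  set χl : SiteY i → ℝ := bumpY i (ctrR i c) (3 * (SC i c : ℝ)) with hχl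
  set SL : Finset (geo9K i).Site :=
    Finset.univ.filter (fun a : (geo9K i).Site => ∃ z : SiteY i, ιB (blkOf i.D.toDomains z) = a ∧ NearC i c (21 * SC i c / 8 + 1) z.1) with hSL
  have hSb : 0 ≤ ∑ j, ‖b j‖ := Finset.sum_nonneg fun _ _ => norm_nonneg _
  have hD1 : 0 ≤ D1 thetaProf := D1_nonneg contDiff_thetaProf hasCompactSupport_thetaProf
  have hlen0 : ∀ y : (geo9K i).Site, 0 ≤ (geo9K i).len y := fun y => (B6KLevelCensusIndexV1.len_pos i y).le
  have hc1 : 0 ≤ B6.c1 dB δ₀ (aG - α - asep - ρ) := c1_nonneg dB δ₀ _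
  have eop : (O (cfg U₁) - GpCubeY i c parS V') ∘ₗ cutMulY (𝔸 := 𝔸) χl =
      ((1 - cutMulY (𝔸 := 𝔸) (chiY i c)) ∘ₗ O (cfg U₁)) ∘ₗ cutMulY (𝔸 := 𝔸) χl +
        ((GpCubeY i c parS V' * (deltaPrimeACubeY i c parS V' * cutMulY (𝔸 := 𝔸) (chiY i c) - cutMulY (𝔸 := 𝔸) (chiY i c) * deltaPrimeACubeY i c parS V')) ∘ₗ
          O (cfg U₁)) ∘ₗ cutMulY (𝔸 := 𝔸) χl := hId
  have e2 : (((etaS i ^ 2) • ((O (cfg U₁) - GpCubeY i c parS V') ∘ₗ cutMulY (𝔸 := 𝔸) χl)).restrictScalars ℝ : Module.End ℝ (SiteY i → 𝔸)) =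
      ((etaS i ^ 2) • (((1 - cutMulY (𝔸 := 𝔸) (chiY i c)) ∘ₗ O (cfg U₁)) ∘ₗ cutMulY (𝔸 := 𝔸) χl)).restrictScalars ℝ +
        ((etaS i ^ 2) • (((GpCubeY i c parS V' * (deltaPrimeACubeY i c parS V' * cutMulY (𝔸 := 𝔸) (chiY i c) -
          cutMulY (𝔸 := 𝔸) (chiY i c) * deltaPrimeACubeY i c parS V')) ∘ₗ O (cfg U₁)) ∘ₗ cutMulY (𝔸 := 𝔸) χl)).restrictScalars ℝ := by
    rw [eop, smul_add]
    exact LinearMap.ext fun _ => rfl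
  have hG := hasMajorant_gapPieceR i c b cfg O parS (Rr := Rr) (Hp := Hp) hE hBG ιB hι hM₂ hrepr hη ν hδ₀ haG hα hΛ hT1 hasep hsplit
  have hK := hasMajorant_commPieceR i c b cfg O parS (Rr := Rr) (Hp := Hp) hE hBG ιB hι hM₂ hrepr hη ν V' dB hδ₀ haG hα hΛ hT1 hθK hΛst hTst hasep hρ
    hsplitL h261 hGK
  rw [e2, B9Thm39CinvTorusRegular.conj_add, add_mul]
  refine hasMajorant_mono (g := toB6 (geo9K i) Rr Hp) _ (hasMajorant_add (g := toB6 (geo9K i) Rr Hp) _ hG hK) fun (a a' : (geo9K i).Site) => ?_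
  have hla : 0 ≤ (geo9K i).len a := hlen0 a
  have hX1 : 0 ≤ (M₂ * (∑ j, ‖b j‖) * BG * (1 + Λ * (D1 thetaProf / 3)) * Real.exp (-(asep * δ₀ * (3 / 8 * (i.Mh : ℝ) - 1)))) * (geo9K i).len a *
      Real.exp (-(ρ * δ₀ * (geo9K i).dist a a')) := by positivity
  have hX2 : 0 ≤ (M₂ * (∑ j, ‖b j‖) * BG * (1 + Λ * (D1 thetaProf / 3)) * θK * Λst * B6.c1 dB δ₀ (aG - α - asep - ρ) *
      Real.exp (-(asep * δ₀ * (3 / 8 * (i.Mh : ℝ) - 3)))) * (geo9K i).len a * Real.exp (-(ρ * δ₀ * (geo9K i).dist a a')) := by positivity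
  show (if a' ∈ SL then (1 : ℝ) else 0) * _ + (if a' ∈ SL then (1 : ℝ) else 0) * _ ≤ _
  by_cases ha' : a' ∈ SL
  · rw [if_pos ha', one_mul, one_mul]
    exact le_of_eq (by ring)
  · rw [if_neg ha', zero_mul, zero_mul, zero_add]
    positivity

open Classical in
set_option maxHeartbeats 1600000 in
/-- ★★★ **`hDR □ ν` AT THE (3.35) DATUM** (`parS := parSymY i`, `G′ := GpY i parSymY`, `V′ := gaugeY i g⁻¹ (locCfgY i □ η A)`): F3-E1 §4 `GpY_sub_GpCubeY_cutMulY_eq_at`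
DISCHARGES `hId` (with p21 `comm_cutMulY_chiY_deltaPrimeACubeY` turning `−K_{χ_□}` into the bracket and F3-E2a `chiL_mul_chiY`); displayed: `hE`, `hGK`, the units, `η = |c_f|⁻¹`,
transfers, member, budgets — the supplier of F3-P ∕ F3-PT's `hDR □ ν` at `Gp := GpY i (parSymY i)`, `χ □ := χ_l`.
[cite: Balaban1985BackgroundPropagators, p.415 l.29–31, p.412 l.22–36, (3.100) p.413, (3.88)–(3.89) p.409, (3.33) p.396, Cor. 3.6 p.408, Thm 3.1 (3.42) p.397; Balaban1983RegularityDecay, (1.11)–(1.12) (statement type; derivation ours); Balaban1984PropagatorsII, (2.83)–(2.85) pp.237–238, Lemma 2.1 (2.60)–(2.61) p.234] -/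
theorem hasMajorant_hDR_at {BG δG : ℝ} (hE : EBlock (kernelFamilySInv i B cfg (GpY i (parSymY i)) (parSymY i)) BG δG U₁) (hBG : 0 ≤ BG)
    (ιB : BlkY i → IBondY i) (hι : ∀ s, β i.hN i.D i.hk (ιB s) = s)
    {M₂ : ℝ} (hM₂ : 0 ≤ M₂) (hrepr : ∀ (v : 𝔸) (j : ι), |b.repr v j| ≤ M₂ * ‖v‖) (hη : etaS i = |i.cf|⁻¹) (ν : Fin (d + 1))
    (g : GaugeY 𝔸 i) (η : ℝ) (A : AfldY 𝔸 i) {Q : Set (Site (PV d ℓ i.m i.K hd hL) 0)}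
    (hQ : ∀ x : Site (PV d ℓ i.m i.K hd hL) 0, NearC i c (35 * SC i c / 8 + 1) (boxEquiv i.hN x).1 → x ∈ Q)
    (hgA : ∀ (κ : Fin (d + 1)) (x : Site (PV d ℓ i.m i.K hd hL) 0), x ∈ Q → x.shift κ ∈ Q → gaugeY i g (cfg U₁) κ x = fluct η A κ x)
    (hU : IsUnit (deltaPrimeAY i (parSymY i) (cfg U₁))) (hV : IsUnit (deltaPrimeACubeY i c (parSymY i) (gaugeY i g⁻¹ (locCfgY i c η A))))
    (dB : ℕ) {δ₀ aG α Λ θK bK αst Λst asep ρ : ℝ} (hδ₀ : 0 ≤ δ₀) (haG : aG * δ₀ ≤ δG) (hα : 0 ≤ α) (hΛ : 0 ≤ Λ)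
    (hT1 : ScaleTransfer (geo9K i) δ₀ α Λ (fun a => (geo9K i).len a)) (hθK : 0 ≤ θK) (hΛst : 0 ≤ Λst)
    (hTst : ScaleTransfer (geo9K i) δ₀ αst Λst (fun a => (geo9K i).len a)) (hasep : 0 ≤ asep) (hρ : 0 ≤ ρ) (hsplitL : αst + ρ ≤ bK)
    (hsplit : α + asep + ρ ≤ aG) (h261 : Ineq261 dB (toB6 (geo9K i) Rr Hp) δ₀ (aG - α - asep - ρ))
    (hGK : HasMajorant (g := toB6 (geo9K i) Rr Hp) (fun p : SiteY i × ι => ιB (blkOf i.D.toDomains p.1))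
      (conj b (((GpCubeY i c (parSymY i) (gaugeY i g⁻¹ (locCfgY i c η A)) *
          (deltaPrimeACubeY i c (parSymY i) (gaugeY i g⁻¹ (locCfgY i c η A)) * cutMulY (𝔸 := 𝔸) (chiY i c) -
            cutMulY (𝔸 := 𝔸) (chiY i c) * deltaPrimeACubeY i c (parSymY i) (gaugeY i g⁻¹ (locCfgY i c η A)))).restrictScalars ℝ :
        Module.End ℝ (SiteY i → 𝔸))))
      (fun (a y'' : (geo9K i).Site) => θK * Real.exp (-(bK * δ₀ * (geo9K i).dist a y'')))) :
    HasMajorant (g := toB6 (geo9K i) Rr Hp) (fun p : SiteY i × ι => ιB (blkOf i.D.toDomains p.1))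
      (conj b (((etaS i ^ 2) • ((GpY i (parSymY i) (cfg U₁) - GpCubeY i c (parSymY i) (gaugeY i g⁻¹ (locCfgY i c η A))) ∘ₗ
          cutMulY (𝔸 := 𝔸) (bumpY i (ctrR i c) (3 * (SC i c : ℝ))))).restrictScalars ℝ) *
        conj b (diffLetter (shiftY i) (UboxY i (cfg U₁)) (((etaS i : ℝ) : ℂ))⁻¹ (Sum.inr ν)))
      (fun a a' => (M₂ * (∑ j, ‖b j‖) * BG * (1 + Λ * (D1 thetaProf / 3)) *
          (Real.exp (-(asep * δ₀ * (3 / 8 * (i.Mh : ℝ) - 1))) +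
            θK * Λst * B6.c1 dB δ₀ (aG - α - asep - ρ) * Real.exp (-(asep * δ₀ * (3 / 8 * (i.Mh : ℝ) - 3))))) *
        (geo9K i).len a * Real.exp (-(ρ * δ₀ * (geo9K i).dist a a'))) := by
  have hId := GpY_sub_GpCubeY_cutMulY_eq_at i c g (cfg U₁) η A hQ hgA hU hV (bumpY i (ctrR i c) (3 * (SC i c : ℝ))) (chiL_mul_chiY i c)
  rw [← comm_cutMulY_chiY_deltaPrimeACubeY i c (gaugeY i g⁻¹ (locCfgY i c η A)), neg_sub] at hId
  exact hasMajorant_hDR_of_identity i c b cfg (GpY i (parSymY i)) (parSymY i) hE hBG ιB hι hM₂ hrepr hη ν (gaugeY i g⁻¹ (locCfgY i c η A)) dB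
    hδ₀ haG hα hΛ hT1 hθK hΛst hTst hasep hρ hsplitL hsplit h261 hGK hId

end AssemblyR

end Literature.MathematicalPhysics.QuantumFieldTheory.Balaban1983to89.B9Eq3105FamThreeLocDiffGRight

end
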